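import Literature.Barriers.CriticalPhenomena.KozmaNachmiasLemma44
import Literature.Barriers.CriticalPhenomena.KozmaNachmiasExploration
import Literature.Barriers.CriticalPhenomena.KozmaNachmiasVolumeTailHolds
import HarnessLib

/-!
# Kozma–Nachmias 2011, Theorem 5 and Theorem 4 (the regularity theorem)

Barrier catalogue, critical phenomena — the last step of the Chapter-4 programme towards the named
fact `KozmaNachmias2011_thm4` of `KozmaNachmiasRegularity.lean` (the regularity theorem used in
Chapter 5 of Kozma–Nachmias for the one-arm exponent, `KozmaNachmias2011_thm2`). We PROVE

* `KozmaNachmias2011_thm4_of (h11 : KozmaNachmias2011_volumeTail) : KozmaNachmias2011_thm4` and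
* **`KozmaNachmias2011_thm4_holds : KozmaNachmias2011_thm4`** — the DISCHARGE of the named fact,

i.e. Theorem 4 exactly as vendored, from the volume estimate (1.1) (the named fact
`KozmaNachmias2011_volumeTail`, discharged in `KozmaNachmiasVolumeTailHolds.lean` from
Aizenman–Newman's `γ = 1`) and the large-deviation estimate of Lemma 4.4 (Aizenman 1997, Lemma 2),
PROVED in `KozmaNachmiasLemma44.lean` (`volumeLD_of_twoPointBoundedRatio`, via the general
tree-graph bound of `TreeGraphBoundGeneral.lean`). The proof follows the source (§4.4, pp. 396–398):

1. *Claim 4.2* (`irrBoundaryConnCount_le_locIrr`, `KozmaNachmiasLocalBad.lean`): almost surely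
   `X_j^{K-irr} ≤ X_j^{K-loc-irr}`, so it suffices to prove **Theorem 5**, the same bound for the
   locally irregular vertices.
2. *One bad scale* (`exists_sq_mul_locBad_ge`): if `X_j ≤ 2 X_j^{K-loc-irr}` then
   `X_j ≤ s² X_j^{s-loc-bad}` for some `s ≥ K` (`Σ_{s ≥ K} s⁻² ≤ 1/(K-1) ≤ 1/2`), whence a union over
   `s` of the events `F_s = {M ≤ X_j ≤ s² X_j^{s-loc-bad}}` (`badScaleEvent`, `thm5Event_subset_iUnion`).
3. *The shifts* (`shiftSet`, `exists_shift_near`, `exists_shift_of_le`): one of the `2^d` grids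
   `G(w) = 2S + w + (4S+1)ℤ^d`, `S = s^{4d²}`, has `X_j ≤ 2^d s² X_j^{s-loc-bad}(w)`, where
   `X_j^{s-loc-bad}(w)` (`shiftBadCount`) counts the bad vertices whose local box lies in their grid
   box.
4. *The exploration* (`real_shiftEvent_le`, from `KozmaNachmiasExploration.lean`): exploring
   `C(0; Q_j)` box by box, every designated probe hits `∂Q_j` with probability `≥ μ₀` (Corollary
   3.2) and is bad with probability `≤ ρ` (Lemma 4.3 and locality); the number of hits is at most
   `X_j` and the marked bad vertices number at most `(4S+1)^d` times the bad probes; Lemma 4.5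
   (few hits among `τ > 4X_j/μ₀` probes) and Lemma 4.6 (a fraction `≥ μ₀/(4β)` of bad probes) in
   Chernoff form give `P(F_{s,w}) ≤ (8/μ₀) e^{-M} + (|G|+1) e^{-M/(2β)}`, `β = 2^d s² (4S+1)^d`.
5. *The sum over the scales* (`thm5_main_regime`): (4.7) for `K ≤ s ≤ s₀ = ⌊M^κ⌋`,
   `κ = 1/(16 d³ (2+4d³))`, and the crude bound (4.8) `P(F_s) ≤ |∂Q_j| sup_x P(x is s-loc-bad)`
   for `s > s₀`; the arithmetic is in `thm5_cond` (the choice of `K₀`), `thm5_arith` and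
   `sum_exp_neg_log_pow_four_le`; small `M` and `M > |∂Q_j|` are trivial (`KozmaNachmias2011_thm4_of`).

All statements are proved; no named facts are introduced.

## References

* G. Kozma, A. Nachmias, *Arm exponents in high dimensional percolation*, J. Amer. Math. Soc. 24
  (2011) 375–409, §4.2 (Theorem 4, Claim 4.2), §4.4 (Theorem 5, Lemmas 4.5–4.6, (4.7)–(4.8)).
* M. Aizenman, *On the number of incipient spanning clusters*, Nucl. Phys. B 485 (1997) 551–582,
  §4.3 Lemma 2 (Lemma 4.4 of Kozma–Nachmias, `KozmaNachmiasLemma44.lean`).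
* G. Grimmett, *Percolation*, 2nd ed., Springer 1999, §7.2 (sequential explorations).
-/

noncomputable section

namespace Literature.Barriers.CriticalPhenomena

open _root_.MeasureTheory Finset Literature.Probability.LatticeModels Literature.Probability.Percolation
  Literature.Probability.Percolation.DCT16 ProbeHistory
open scoped Literature.Probability.LatticeModels Literature.Probability.Percolation Classical

variable {d : ℕ}

/-! ### Combinatorial reductions -/

section Reductions

/-- `Σ_{s ∈ T} 1/s² ≤ 1/(K-1)` for a finite set `T` of integers `≥ K ≥ 2`. [folklore] -/
theorem sum_inv_sq_le {K : ℕ} (hK : 2 ≤ K) {T : Finset ℕ} (hT : ∀ s ∈ T, K ≤ s) :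
    ∑ s ∈ T, ((s : ℝ) ^ 2)⁻¹ ≤ ((K : ℝ) - 1)⁻¹ := by
  -- `T ⊆ [K, N]`
  obtain ⟨N, hN⟩ : ∃ N, ∀ s ∈ T, s < N := ⟨T.sup id + 1, fun s hs => Nat.lt_succ_of_le (Finset.le_sup (f := id) hs)⟩
  have hsub : T ⊆ Finset.Ico K N := fun s hs => Finset.mem_Ico.2 ⟨hT s hs, hN s hs⟩
  have hterm : ∀ s ∈ Finset.Ico K N, ((s : ℝ) ^ 2)⁻¹ ≤ ((s : ℝ) - 1)⁻¹ - (s : ℝ)⁻¹ := by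
    intro s hs
    have hs2 : (2 : ℝ) ≤ s := by exact_mod_cast hK.trans (Finset.mem_Ico.1 hs).1
    rw [inv_sub_inv (by linarith) (by linarith), show (s : ℝ) - (s - 1) = 1 by ring, one_div, inv_le_inv₀ (by positivity)
      (by nlinarith)]
    nlinarith
  have hnonneg : ∀ s ∈ Finset.Ico K N, 0 ≤ ((s : ℝ) ^ 2)⁻¹ := fun s _ => by positivity
  set F : ℕ → ℝ := fun k => -(((K : ℝ) + k - 1)⁻¹) with hF
  have hK1 : (1 : ℝ) ≤ K := by exact_mod_cast (show 1 ≤ K by omega)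
  calc ∑ s ∈ T, ((s : ℝ) ^ 2)⁻¹ ≤ ∑ s ∈ Finset.Ico K N, ((s : ℝ) ^ 2)⁻¹ :=
        Finset.sum_le_sum_of_subset_of_nonneg hsub fun s hs _ => hnonneg s hs
    _ ≤ ∑ s ∈ Finset.Ico K N, (((s : ℝ) - 1)⁻¹ - (s : ℝ)⁻¹) := Finset.sum_le_sum hterm
    _ = ∑ k ∈ Finset.range (N - K), ((((K + k : ℕ) : ℝ) - 1)⁻¹ - (((K + k : ℕ) : ℝ))⁻¹) := by
        rw [Finset.sum_Ico_eq_sum_range]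
    _ = ∑ k ∈ Finset.range (N - K), (F (k + 1) - F k) := by
        refine Finset.sum_congr rfl fun k _ => ?_
        simp only [hF]; push_cast; ring
    _ = F (N - K) - F 0 := Finset.sum_range_sub F _
    _ ≤ ((K : ℝ) - 1)⁻¹ := by
        simp only [hF, Nat.cast_zero, add_zero]
        have h0 : 0 ≤ ((K : ℝ) + ((N - K : ℕ) : ℝ) - 1)⁻¹ :=
          inv_nonneg.2 (by have : (0 : ℝ) ≤ ((N - K : ℕ) : ℝ) := Nat.cast_nonneg _; linarith)
        linarith

/-- **From `K`-local irregularity to one bad scale** (Kozma–Nachmias 2011, proof of Theorem 5: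
"if `Σ_{s ≥ K} X_j^{s-loc-bad} ≥ X_j/2`, then there exists `s ≥ K` such that
`X_j^{s-loc-bad} ≥ X_j/s²` for `K ≥ 3`"): here with `X_j^{K-loc-irr} ≤ Σ_s X_j^{s-loc-bad}`
built in. [cite: KozmaNachmias2011, proof of Theorem 5 (p. 396)] -/
theorem exists_sq_mul_locBad_ge (p : unitInterval) {j K : ℕ} (hK : 3 ≤ K) {ω : BondConfig (Site d)}
    (h : boundaryConnCount d j ω ≤ 2 * locIrrBoundaryConnCount d p j K ω) :
    ∃ s, K ≤ s ∧ boundaryConnCount d j ω ≤ s ^ 2 * locBadBoundaryConnCount d p j s ω := by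
  classical
  by_contra hne
  push Not at hne
  set I := (sphere d j).filter fun x =>
    ω ∈ openConnIn (↑(box d j) : Set (Site d)) (0 : Site d) x ∧ IsKLocIrregular p j K x ω with hI
  have hIcard : locIrrBoundaryConnCount d p j K ω = #I := rfl
  -- choose a bad scale for every irregular vertex
  have hch : ∀ x ∈ I, ∃ s, K ≤ s ∧ IsSLocBad p j s x ω := fun x hx => (Finset.mem_filter.1 hx).2.2
  choose! sx hsx using hch
  set T := I.image sx with hT
  have hTK : ∀ s ∈ T, K ≤ s := by
    intro s hs
    obtain ⟨x, hx, rfl⟩ := Finset.mem_image.1 hs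
    exact (hsx x hx).1
  -- `#I ≤ Σ_{s ∈ T} X_j^{s-loc-bad}`
  have hIle : (#I : ℝ) ≤ ∑ s ∈ T, (locBadBoundaryConnCount d p j s ω : ℝ) := by
    have h1 : #I = ∑ s ∈ T, #(I.filter fun x => sx x = s) := Finset.card_eq_sum_card_image sx I
    have h2 : ∀ s ∈ T, #(I.filter fun x => sx x = s) ≤ locBadBoundaryConnCount d p j s ω := by
      intro s _
      unfold locBadBoundaryConnCount
      refine Finset.card_le_card fun x hx => ?_
      obtain ⟨hxI, hxs⟩ := Finset.mem_filter.1 hx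
      obtain ⟨hxS, hconn, -⟩ := Finset.mem_filter.1 hxI
      exact Finset.mem_filter.2 ⟨hxS, hconn, hxs ▸ (hsx x hxI).2⟩
    calc (#I : ℝ) = ∑ s ∈ T, (#(I.filter fun x => sx x = s) : ℝ) := by rw [h1]; push_cast; rfl
      _ ≤ _ := Finset.sum_le_sum fun s hs => by exact_mod_cast h2 s hs
  -- each term is `< X_j/s²`
  have hXpos : 0 < boundaryConnCount d j ω := by
    by_contra h0
    push Not at h0
    have := hne K le_rfl
    omega
  have hterm : ∀ s ∈ T, (locBadBoundaryConnCount d p j s ω : ℝ) < boundaryConnCount d j ω * ((s : ℝ) ^ 2)⁻¹ := by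
    intro s hs
    have hs0 : (0 : ℝ) < (s : ℝ) ^ 2 := by
      have : (3 : ℝ) ≤ s := by exact_mod_cast hK.trans (hTK s hs)
      positivity
    rw [lt_mul_inv_iff₀ hs0]
    have := hne s (hTK s hs)
    have h' : ((s ^ 2 * locBadBoundaryConnCount d p j s ω : ℕ) : ℝ) < boundaryConnCount d j ω := by exact_mod_cast this
    push_cast at h'
    linarith
  have hTne : T.Nonempty := by
    rw [Finset.nonempty_iff_ne_empty]
    intro hT0
    rw [hT0, Finset.sum_empty] at hIle
    have hI0 : #I = 0 := by exact_mod_cast le_antisymm hIle (Nat.cast_nonneg _)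
    rw [hIcard, hI0] at h
    omega
  have hlt : (#I : ℝ) < boundaryConnCount d j ω * ((K : ℝ) - 1)⁻¹ := by
    calc (#I : ℝ) ≤ ∑ s ∈ T, (locBadBoundaryConnCount d p j s ω : ℝ) := hIle
      _ < ∑ s ∈ T, boundaryConnCount d j ω * ((s : ℝ) ^ 2)⁻¹ := Finset.sum_lt_sum_of_nonempty hTne hterm
      _ = boundaryConnCount d j ω * ∑ s ∈ T, ((s : ℝ) ^ 2)⁻¹ := by rw [Finset.mul_sum]
      _ ≤ boundaryConnCount d j ω * ((K : ℝ) - 1)⁻¹ :=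
          mul_le_mul_of_nonneg_left (sum_inv_sq_le (by omega) hTK) (Nat.cast_nonneg _)
  -- contradiction with `X_j ≤ 2 X_j^{K-loc-irr}` for `K ≥ 3`
  have hK3 : (3 : ℝ) ≤ K := by exact_mod_cast hK
  have hK2 : ((K : ℝ) - 1)⁻¹ ≤ 1 / 2 := by
    rw [one_div, inv_le_inv₀ (by linarith) two_pos]
    linarith
  have h2 : (boundaryConnCount d j ω : ℝ) ≤ 2 * #I := by rw [← hIcard]; exact_mod_cast h
  have hX0 : (0 : ℝ) ≤ boundaryConnCount d j ω := Nat.cast_nonneg _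
  nlinarith

/-- **The `2^d` shifts** `W = {w : w_i ∈ {0, 2S}}` (Kozma–Nachmias 2011, proof of Theorem 5).
[cite: KozmaNachmias2011, proof of Theorem 5 (p. 396)] -/
def shiftSet (d S : ℕ) : Finset (Site d) :=
  (Finset.univ : Finset (Fin d → Bool)).image fun b i => if b i then (2 * S : ℤ) else 0

/-- `|W| ≤ 2^d`. [folklore] -/
theorem card_shiftSet_le (d S : ℕ) : #(shiftSet d S) ≤ 2 ^ d := by
  refine Finset.card_image_le.trans ?_
  rw [Finset.card_univ, Fintype.card_fun, Fintype.card_bool, Fintype.card_fin]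

/-- `W` is non-empty. [folklore] -/
theorem shiftSet_nonempty (d S : ℕ) : (shiftSet d S).Nonempty :=
  ⟨_, Finset.mem_image.2 ⟨fun _ => false, Finset.mem_univ _, rfl⟩⟩

/-- The displacement from the grid point of `u`, coordinatewise: `u_i - (gridOf u)_i = m - 2S` with
`m = (u_i - w_i + 2S) mod (4S+1)`. [folklore] -/
theorem sub_gridOf_apply (S : ℕ) (w u : Site d) (i : Fin d) :
    u i - gridOf S w u i = (u i - w i + 2 * S) % (4 * S + 1 : ℤ) - 2 * S := by
  simp only [gridOf]
  rw [Int.emod_def]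
  ring

/-- **Covering by shifts** (Kozma–Nachmias 2011, proof of Theorem 5: "for any `x ∈ ℤ^d` there
exists some `w ∈ W` such that `x + Q_{s^{4d²}} ⊂ q`" for a box `q` of `G(w)`): some shift puts `x`
within sup-distance `S` of its grid point. [cite: KozmaNachmias2011, proof of Theorem 5 (p. 396)] -/
theorem exists_shift_near (S : ℕ) (x : Site d) : ∃ w ∈ shiftSet d S, x - gridOf S w x ∈ box d S := by
  set m : ℤ := 4 * S + 1 with hm
  have hm0 : 0 < m := by rw [hm]; positivity
  -- the choice: shift `2S` in coordinate `i` iff the residue of `x_i` lies in `[S, 3S]`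
  set b : Fin d → Bool := fun i => decide ((S : ℤ) ≤ x i % m ∧ x i % m ≤ 3 * S) with hb
  refine ⟨fun i => if b i then (2 * S : ℤ) else 0, Finset.mem_image.2 ⟨b, Finset.mem_univ _, rfl⟩, ?_⟩
  rw [mem_box]
  intro i
  rw [Pi.sub_apply, sub_gridOf_apply]
  set r := x i % m with hr
  have hr0 : 0 ≤ r := Int.emod_nonneg _ hm0.ne'
  have hrm : r < m := Int.emod_lt_of_pos _ hm0
  have hx : x i = r + m * (x i / m) := by rw [hr, Int.emod_add_mul_ediv] 
  by_cases hmid : (S : ℤ) ≤ r ∧ r ≤ 3 * S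
  · have hbi : b i = true := by rw [hb]; exact decide_eq_true hmid
    simp only [hbi, if_true]
    have : (x i - 2 * S + 2 * S) % (4 * S + 1 : ℤ) = r := by rw [sub_add_cancel, hr, hm]
    rw [this]
    constructor <;> omega
  · have hbi : b i = false := by rw [hb]; exact decide_eq_false hmid
    simp only [hbi]
    rw [if_neg (by simp), sub_zero]
    rcases not_and_or.1 hmid with h1 | h1
    · push Not at h1
      -- `r < S`: residue `r + 2S`
      have : (x i + 2 * S) % (4 * S + 1 : ℤ) = r + 2 * S := by
        rw [hx, show r + m * (x i / m) + 2 * S = (r + 2 * S) + m * (x i / m) by ring, ← hm, Int.add_mul_emod_self_left,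
          Int.emod_eq_of_lt (by omega) (by rw [hm]; omega)]
      rw [this]
      constructor <;> omega
    · push Not at h1
      -- `r > 3S`: residue `r - 2S - 1`
      have : (x i + 2 * S) % (4 * S + 1 : ℤ) = r - 2 * S - 1 := by
        rw [hx, show r + m * (x i / m) + 2 * S = (r - 2 * S - 1) + m * (x i / m + 1) by rw [hm]; ring, ← hm,
          Int.add_mul_emod_self_left, Int.emod_eq_of_lt (by omega) (by rw [hm]; omega)]
      rw [this]
      constructor <;> omega

/-- If `x` is within `S` of its grid point `v`, its local box `(x + Q_S) ∩ Q_j` lies in the grid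
box `q_v = (v + Q_{2S}) ∩ Q_j`. [cite: KozmaNachmias2011, proof of Theorem 5 (p. 396)] -/
theorem locBox_subset_qbox {j s : ℕ} {w x : Site d} (hx : x - gridOf (locScale d s) w x ∈ box d (locScale d s)) :
    locBox d j s x ⊆ qbox j (locScale d s) (gridOf (locScale d s) w x) := by
  intro u hu
  obtain ⟨huj, hux⟩ := Finset.mem_filter.1 hu
  refine mem_qbox.2 ⟨huj, ?_⟩
  rw [mem_box] at hux hx ⊢
  intro i
  obtain ⟨h1, h2⟩ := hux i
  obtain ⟨h3, h4⟩ := hx i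
  simp only [Pi.sub_apply] at h1 h2 h3 h4 ⊢
  constructor <;> push_cast at h1 h2 h3 h4 ⊢ <;> linarith

/-- **The marks of shift `w`**: `x` is `s`-locally-bad and its local box lies in the grid box of
`x` for the shift `w` (the vertices counted in `X_j^{s-loc-bad}(w)`).
[cite: KozmaNachmias2011, §4.4 (definition of X_j^{s-loc-bad}(w), p. 395)] -/
def shiftMark (p : unitInterval) (j s : ℕ) (w x : Site d) : Set (BondConfig (Site d)) :=
  {ω | locBox d j s x ⊆ qbox j (locScale d s) (gridOf (locScale d s) w x) ∧ IsSLocBad p j s x ω}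

open scoped Classical in
/-- **`X_j^{s-loc-bad}(w)`** (Kozma–Nachmias 2011, p. 395), with the connection to the origin. [cite: KozmaNachmias2011, §4.4 (p. 395)] -/
def shiftBadCount (d : ℕ) (p : unitInterval) (j s : ℕ) (w : Site d) (ω : BondConfig (Site d)) : ℕ :=
  #((sphere d j).filter fun x =>
    ω ∈ openConnIn (↑(box d j) : Set (Site d)) (0 : Site d) x ∧ ω ∈ shiftMark p j s w x)

/-- `X_j^{s-loc-bad} ≤ Σ_{w ∈ W} X_j^{s-loc-bad}(w)`. [cite: KozmaNachmias2011, proof of Theorem 5 (p. 396)] -/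
theorem locBadBoundaryConnCount_le_sum_shifts (p : unitInterval) (j s : ℕ) (ω : BondConfig (Site d)) :
    locBadBoundaryConnCount d p j s ω ≤ ∑ w ∈ shiftSet d (locScale d s), shiftBadCount d p j s w ω := by
  classical
  unfold locBadBoundaryConnCount shiftBadCount
  calc #((sphere d j).filter fun x => ω ∈ openConnIn (↑(box d j) : Set (Site d)) (0 : Site d) x ∧ IsSLocBad p j s x ω)
      ≤ #((shiftSet d (locScale d s)).biUnion fun w => (sphere d j).filter fun x =>
          ω ∈ openConnIn (↑(box d j) : Set (Site d)) (0 : Site d) x ∧ ω ∈ shiftMark p j s w x) := by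
        refine Finset.card_le_card fun x hx => ?_
        obtain ⟨hxS, hconn, hbad⟩ := Finset.mem_filter.1 hx
        obtain ⟨w, hw, hxw⟩ := exists_shift_near (locScale d s) x
        exact Finset.mem_biUnion.2 ⟨w, hw, Finset.mem_filter.2 ⟨hxS, hconn, locBox_subset_qbox hxw, hbad⟩⟩
    _ ≤ _ := Finset.card_biUnion_le

/-- **Pigeonhole over the shifts**: if `X_j ≤ s² X_j^{s-loc-bad}`, then for some shift `w`,
`X_j ≤ 2^d s² X_j^{s-loc-bad}(w)`. [cite: KozmaNachmias2011, proof of Theorem 5 (p. 396)] -/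
theorem exists_shift_of_le (p : unitInterval) {j s : ℕ} {ω : BondConfig (Site d)}
    (h : boundaryConnCount d j ω ≤ s ^ 2 * locBadBoundaryConnCount d p j s ω) :
    ∃ w ∈ shiftSet d (locScale d s), boundaryConnCount d j ω ≤ 2 ^ d * s ^ 2 * shiftBadCount d p j s w ω := by
  obtain ⟨w, hw, hmax⟩ := Finset.exists_max_image (shiftSet d (locScale d s)) (fun w => shiftBadCount d p j s w ω)
    (shiftSet_nonempty d _)
  refine ⟨w, hw, ?_⟩
  have h1 := locBadBoundaryConnCount_le_sum_shifts p j s ω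
  have h2 : ∑ w' ∈ shiftSet d (locScale d s), shiftBadCount d p j s w' ω ≤ 2 ^ d * shiftBadCount d p j s w ω :=
    calc ∑ w' ∈ shiftSet d (locScale d s), shiftBadCount d p j s w' ω
        ≤ ∑ _w' ∈ shiftSet d (locScale d s), shiftBadCount d p j s w ω := Finset.sum_le_sum hmax
      _ = #(shiftSet d (locScale d s)) * shiftBadCount d p j s w ω := by rw [Finset.sum_const, smul_eq_mul]
      _ ≤ 2 ^ d * shiftBadCount d p j s w ω := Nat.mul_le_mul_right _ (card_shiftSet_le d _)
  calc boundaryConnCount d j ω ≤ s ^ 2 * locBadBoundaryConnCount d p j s ω := h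
    _ ≤ s ^ 2 * (2 ^ d * shiftBadCount d p j s w ω) := Nat.mul_le_mul_left _ (h1.trans h2)
    _ = 2 ^ d * s ^ 2 * shiftBadCount d p j s w ω := by ring

/-- The marks of a shift are determined by the pairs of the grid boxes (for the same shift).
[folklore] -/
theorem determinedBy_shiftMark (p : unitInterval) (j s : ℕ) (w : Site d) {v : Site d}
    (hv : v ∈ gridPts j (locScale d s) w) {x : Site d} (hx : x ∈ qbox j (locScale d s) v) :
    DeterminedBy (shiftMark p j s w x) ↑(qbox j (locScale d s) v).sym2 := by
  by_cases hC : locBox d j s x ⊆ qbox j (locScale d s) (gridOf (locScale d s) w x)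
  · have hvx : v = gridOf (locScale d s) w x :=
      eq_of_mem_qbox_of_mem_qbox (mem_gridPts.1 hv).2.1 (isGridPt_gridOf _ w x) hx
        (mem_qbox_gridOf _ w (qbox_subset_box j _ v hx))
    have hdet := (determinedBy_isSLocBad p j s x).mono (Finset.coe_subset.2 (Finset.sym2_mono (hvx ▸ hC)))
    rw [determinedBy_iff] at hdet ⊢
    intro ω ω' hωω'
    simp only [shiftMark, Set.mem_setOf_eq, hC, true_and]
    exact hdet ω ω' hωω'
  · have : shiftMark p j s w x = ∅ := by
      ext ω; simp [shiftMark, hC]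
    rw [this, determinedBy_iff]
    intro ω ω' _; simp

/-- `{x marked for shift w}` is measurable. [folklore] -/
theorem measurableSet_shiftMark (p : unitInterval) (j s : ℕ) (w x : Site d) : MeasurableSet (shiftMark p j s w x) := by
  by_cases hC : locBox d j s x ⊆ qbox j (locScale d s) (gridOf (locScale d s) w x)
  · have : shiftMark p j s w x = {ω | IsSLocBad p j s x ω} := by
      ext ω; simp [shiftMark, hC]
    rw [this]; exact measurableSet_isSLocBad p j s x
  · have : shiftMark p j s w x = ∅ := by
      ext ω; simp [shiftMark, hC]
    rw [this]; exact MeasurableSet.empty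

/-- `X_j^{s-loc-bad}(w)` is measurable. [folklore] -/
theorem measurable_shiftBadCount (d : ℕ) (p : unitInterval) (j s : ℕ) (w : Site d) :
    Measurable fun ω : BondConfig (Site d) => (shiftBadCount d p j s w ω : ℝ) :=
  measurable_card_sphere_conn_and j (P := fun x => shiftMark p j s w x) (measurableSet_shiftMark p j s w)

end Reductions

/-! ### The exploration estimate for one scale and one shift -/

section OneShift

/-- The origin lies in the interior region when `j > 4S` (its grid point is within `2S`, so a
vertex of `∂Q_j` in that grid box would have sup-norm at most `4S`). [folklore] -/
theorem zero_mem_interior (hd : 1 ≤ d) {j S : ℕ} (hj : 4 * S < j) (w : Site d) : (0 : Site d) ∈ interior j S w := by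
  refine mem_interior.2 ⟨zero_mem_box d j, ?_⟩
  rintro ⟨x, hx, hxv⟩
  have hv := sub_gridOf_mem_box S w (0 : Site d)
  rw [mem_sphere] at hx
  obtain ⟨i, hi⟩ := Site.exists_natAbs_eq_supNorm (d := d) ⟨⟨0, hd⟩, Finset.mem_univ _⟩ x
  obtain ⟨h1, h2⟩ := (mem_box.1 hxv) i
  obtain ⟨h3, h4⟩ := (mem_box.1 hv) i
  simp only [Pi.sub_apply, Pi.zero_apply, zero_sub] at h1 h2 h3 h4
  have : (x i).natAbs = j := by rw [hi, hx]
  omega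

/-- `e^{-x} ≤ 1/(1+x)` and hence `1 - e^{-x} ≥ x/2` for `0 ≤ x ≤ 1`. [folklore] -/
theorem half_le_one_sub_exp_neg {x : ℝ} (hx0 : 0 ≤ x) (hx1 : x ≤ 1) : x / 2 ≤ 1 - Real.exp (-x) := by
  have h1 : Real.exp (-x) ≤ 1 / (1 + x) := by
    rw [Real.exp_neg, one_div]
    exact inv_anti₀ (by linarith) (by linarith [Real.add_one_le_exp x])
  have h2 : 1 / (1 + x) ≤ 1 - x / 2 := by
    rw [div_le_iff₀ (by linarith)]
    nlinarith
  linarith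

/-- **The exploration estimate** (Kozma–Nachmias 2011, proof of Theorem 5, the combination of
Lemmas 4.5 and 4.6 for one `s` and one shift `w`): if every boundary box of half-width `2S`,
`S = s^{4d²}`, is hit with probability `≥ μ₀` (Corollary 3.2), every vertex is `s`-locally-bad with
probability `≤ ρ₁` (Lemma 4.3), `j > 4S` and `16 β (4S+1)^d ρ₁ ≤ μ₀` with `β = 2^d s² (4S+1)^d`,
then for `M ≥ 1`
`P(M ≤ X_j ≤ 2^d s² X_j^{s-loc-bad}(w)) ≤ (8/μ₀) e^{-M} + (|G| + 1) e^{-M/(2β)}`: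
on the event either the exploration made `τ > 4X_j/μ₀` designated probes with at most `X_j` hits
(Lemma 4.5), or at least a fraction `μ₀/(4β)` of its `τ` probes were bad (Lemma 4.6).
[cite: KozmaNachmias2011, proof of Theorem 5 (pp. 396–397)] -/
theorem real_shiftEvent_le (hd : 1 ≤ d) (p : unitInterval) {j s : ℕ} (hs : 1 ≤ s)
    (hj : 4 * locScale d s < j) (w : Site d) {μ₀ ρ₁ : ℝ} (hμ0 : 0 < μ₀) (hμ1 : μ₀ ≤ 1) (hρ0 : 0 ≤ ρ₁)
    (hcor : ∀ (x : Site d), (∃ w' ∈ sphere d j, w' - x ∈ box d (2 * locScale d s)) → ∀ y ∈ box d j,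
      y - x ∈ box d (2 * locScale d s) → μ₀ ≤ (bondPercolation (zdGraph d) p).real
        {ω | ∃ w' ∈ sphere d j, ω ∈ openConnIn
          (↑((box d j).filter fun u => u - x ∈ box d (2 * locScale d s)) : Set (Site d)) y w'})
    (hρ : ∀ x : Site d, (bondPercolation (zdGraph d) p).real {ω | IsSLocBad p j s x ω} ≤ ρ₁)
    (hcond : 16 * (2 ^ d * (s : ℝ) ^ 2 * (4 * locScale d s + 1 : ℝ) ^ d) * ((4 * locScale d s + 1 : ℝ) ^ d * ρ₁) ≤ μ₀)
    (M : ℕ) :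
    (bondPercolation (zdGraph d) p).real
        {ω | M ≤ boundaryConnCount d j ω ∧ boundaryConnCount d j ω ≤ 2 ^ d * s ^ 2 * shiftBadCount d p j s w ω} ≤
      8 / μ₀ * Real.exp (-(M : ℝ)) +
        (#(gridPts j (locScale d s) w) + 1) * Real.exp (-(M / (2 * (2 ^ d * (s : ℝ) ^ 2 * (4 * locScale d s + 1 : ℝ) ^ d)))) := by
  classical
  set μ := bondPercolation (zdGraph d) p with hμ
  set S := locScale d s with hS
  set E := knExplorer j S w with hE
  set G := #(gridPts j S w) with hG
  set N := G + 2 with hN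
  set hitF : ProbeHistory (Site d) → Finset (Sym2 (Site d)) → Prop := fun h o => ¬hitPred j S w h o with hhitF
  set Mark : Site d → Set (BondConfig (Site d)) := shiftMark p j s w with hMark
  set badF : ProbeHistory (Site d) → Finset (Sym2 (Site d)) → Prop :=
    fun h o => ¬badPred j S w (markedBad j S Mark) h o with hbadF
  set τ : BondConfig (Site d) → ℕ := fun ω => ndesig knDesig (E.hist N ω) with hτ
  set H : BondConfig (Site d) → ℕ := fun ω => nfail hitF knDesig (E.hist N ω) with hH
  set Bd : BondConfig (Site d) → ℕ := fun ω => nfail badF knDesig (E.hist N ω) with hBd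
  set β : ℝ := 2 ^ d * (s : ℝ) ^ 2 * (4 * S + 1 : ℝ) ^ d with hβ
  set ρ : ℝ := (4 * S + 1 : ℝ) ^ d * ρ₁ with hρdef
  set θ : ℝ := μ₀ / 4 with hθ
  set α : ℝ := θ / β with hα
  have hβ0 : 0 < β := by positivity
  have hθ0 : 0 < θ := by positivity
  have hα0 : 0 < α := div_pos hθ0 hβ0
  have hρ0' : 0 ≤ ρ := by positivity
  have hαρ : 4 * ρ ≤ α := by
    rw [hα, le_div_iff₀ hβ0, hθ]
    have : 16 * β * ρ ≤ μ₀ := by rw [hβ, hρdef]; linarith [hcond]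
    linarith
  -- deterministic facts along the exploration
  have h0 : (0 : Site d) ∈ interior j S w := zero_mem_interior hd hj w
  have hMarkdet : ∀ v ∈ gridPts j S w, ∀ x ∈ qbox j S v, DeterminedBy (Mark x) ↑(qbox j S v).sym2 :=
    fun v hv x hx => determinedBy_shiftMark p j s w hv hx
  have hHX : ∀ ω, H ω ≤ boundaryConnCount d j ω := fun ω => nfail_hit_le_boundaryConnCount ω N
  have hYB : ∀ ω, shiftBadCount d p j s w ω ≤ (4 * S + 1) ^ d * Bd ω := fun ω =>
    card_marked_le h0 hMarkdet (by omega) (next_hist_eq_none ω)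
  have hτG : ∀ ω, τ ω ≤ G := fun ω => ndesig_hist_le ω N
  -- the two families of events
  set Aev : ℕ → Set (BondConfig (Site d)) := fun i =>
    if (M : ℝ) ≤ θ * i then {ω | (H ω : ℝ) ≤ θ * i ∧ i ≤ τ ω} else ∅ with hAev
  set Bev : ℕ → Set (BondConfig (Site d)) := fun i =>
    {ω | max (α * i) (M / β) ≤ Bd ω ∧ τ ω ≤ i} with hBev
  have hcover : {ω | M ≤ boundaryConnCount d j ω ∧ boundaryConnCount d j ω ≤ 2 ^ d * s ^ 2 * shiftBadCount d p j s w ω} ⊆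
      (⋃ i ∈ Finset.range (G + 1), Aev i) ∪ ⋃ i ∈ Finset.range (G + 1), Bev i := by
    rintro ω ⟨hMX, hXY⟩
    have hi : τ ω ∈ Finset.range (G + 1) := Finset.mem_range.2 (Nat.lt_succ_of_le (hτG ω))
    have hXβ : (boundaryConnCount d j ω : ℝ) ≤ β * Bd ω := by
      have h1 : (boundaryConnCount d j ω : ℝ) ≤ 2 ^ d * (s : ℝ) ^ 2 * shiftBadCount d p j s w ω := by exact_mod_cast hXY
      have h2 : (shiftBadCount d p j s w ω : ℝ) ≤ (4 * S + 1 : ℝ) ^ d * Bd ω := by exact_mod_cast hYB ω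
      calc (boundaryConnCount d j ω : ℝ) ≤ 2 ^ d * (s : ℝ) ^ 2 * shiftBadCount d p j s w ω := h1
        _ ≤ 2 ^ d * (s : ℝ) ^ 2 * ((4 * S + 1 : ℝ) ^ d * Bd ω) := mul_le_mul_of_nonneg_left h2 (by positivity)
        _ = β * Bd ω := by rw [hβ]; ring
    by_cases hcase : (boundaryConnCount d j ω : ℝ) < θ * τ ω
    · refine Or.inl (Set.mem_biUnion (Finset.mem_coe.2 hi) ?_)
      have hMθ : (M : ℝ) ≤ θ * τ ω := le_trans (by exact_mod_cast hMX) hcase.le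
      simp only [hAev, if_pos hMθ, Set.mem_setOf_eq]
      exact ⟨le_trans (by exact_mod_cast hHX ω) hcase.le, le_rfl⟩
    · push Not at hcase
      refine Or.inr (Set.mem_biUnion (Finset.mem_coe.2 hi) ?_)
      simp only [hBev, Set.mem_setOf_eq, max_le_iff]
      refine ⟨⟨?_, ?_⟩, le_rfl⟩
      · rw [hα, div_mul_eq_mul_div, div_le_iff₀ hβ0]
        calc θ * τ ω ≤ boundaryConnCount d j ω := hcase
          _ ≤ β * Bd ω := hXβ
          _ = Bd ω * β := mul_comm _ _
      · rw [div_le_iff₀ hβ0]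
        calc (M : ℝ) ≤ boundaryConnCount d j ω := by exact_mod_cast hMX
          _ ≤ β * Bd ω := hXβ
          _ = Bd ω * β := mul_comm _ _
  -- Lemma 4.5 for the first family
  have hA : ∀ i, μ.real (Aev i) ≤ if (M : ℝ) ≤ θ * i then Real.exp (-(μ₀ / 4) * i) else 0 := by
    intro i
    by_cases hMi : (M : ℝ) ≤ θ * i
    · simp only [hAev, if_pos hMi]
      have h := real_few_hits_le (j := j) (S := S) (w := w) p (c := μ₀) (C := 0)
        (by simp; exact hμ0.le) (by simp; exact hμ1) (by simpa using hcor) zero_le_one N i (θ * i)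
      simp only [neg_zero, zero_mul, Real.exp_zero, mul_one] at h
      refine h.trans ?_
      have hbase : 1 - μ₀ * (1 - Real.exp (-1)) ≤ Real.exp (-(μ₀ / 2)) := by
        have he : 1 / 2 ≤ 1 - Real.exp (-1 : ℝ) := by
          have := half_le_one_sub_exp_neg (x := 1) zero_le_one le_rfl
          linarith
        calc 1 - μ₀ * (1 - Real.exp (-1)) ≤ 1 - μ₀ / 2 := by nlinarith
          _ ≤ Real.exp (-(μ₀ / 2)) := by
              have := Real.add_one_le_exp (-(μ₀ / 2)); linarith
      have hbase0 : 0 ≤ 1 - μ₀ * (1 - Real.exp (-1)) := by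
        have : Real.exp (-1 : ℝ) ≤ 1 := Real.exp_le_one_iff.2 (by norm_num)
        have : 0 ≤ 1 - Real.exp (-1 : ℝ) := by linarith
        nlinarith [Real.exp_pos (-1 : ℝ)]
      calc Real.exp (1 * (θ * i)) * (1 - μ₀ * (1 - Real.exp (-1))) ^ i
          ≤ Real.exp (1 * (θ * i)) * Real.exp (-(μ₀ / 2)) ^ i :=
            mul_le_mul_of_nonneg_left (pow_le_pow_left₀ hbase0 hbase i) (Real.exp_pos _).le
        _ = Real.exp (-(μ₀ / 4) * i) := by
            rw [← Real.exp_nat_mul, ← Real.exp_add, hθ]; ring_nf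
    · simp only [hAev, if_neg hMi, measureReal_empty, le_refl]
  -- Lemma 4.6 for the second family
  have hρbox : ∀ v ∈ gridPts j S w, IsBoundaryPt j S v → μ.real (markedBad j S Mark v) ≤ ρ := by
    intro v _ _
    have hsub : markedBad j S Mark v ⊆ ⋃ x ∈ qbox j S v, {ω | IsSLocBad p j s x ω} := by
      rintro ω ⟨x, hx, -, hm⟩
      exact Set.mem_biUnion (Finset.mem_coe.2 hx) hm.2
    calc μ.real (markedBad j S Mark v) ≤ μ.real (⋃ x ∈ qbox j S v, {ω | IsSLocBad p j s x ω}) :=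
          measureReal_mono hsub (measure_ne_top _ _)
      _ ≤ ∑ x ∈ qbox j S v, μ.real {ω | IsSLocBad p j s x ω} := measureReal_biUnion_finset_le _ _
      _ ≤ ∑ _x ∈ qbox j S v, ρ₁ := Finset.sum_le_sum fun x _ => hρ x
      _ = #(qbox j S v) * ρ₁ := by rw [Finset.sum_const, nsmul_eq_mul]
      _ ≤ (4 * S + 1 : ℝ) ^ d * ρ₁ := by
          refine mul_le_mul_of_nonneg_right ?_ hρ0
          exact_mod_cast card_qbox_le j S v
  have hB : ∀ i, μ.real (Bev i) ≤ Real.exp (-(M / (2 * β))) := by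
    intro i
    have hdet : ∀ v ∈ gridPts j S w, DeterminedBy (markedBad j S Mark v) ↑(qbox j S v).sym2 :=
      fun v hv => determinedBy_markedBad (hMarkdet v hv)
    have h := real_many_bad_le (j := j) (S := S) (w := w) p hρ0' hdet hρbox zero_le_one N i (max (α * i) (M / β))
    refine h.trans ?_
    have hai : α * i ≤ max (α * i) (M / β) := le_max_left _ _
    have hMi : M / β ≤ max (α * i) (M / β) := le_max_right _ _
    calc Real.exp (-(1 * max (α * i) (M / β))) * (1 + ρ * (Real.exp 1 - 1)) ^ i
        ≤ Real.exp (-(1 * max (α * i) (M / β))) * Real.exp (2 * ρ) ^ i := by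
          refine mul_le_mul_of_nonneg_left (pow_le_pow_left₀ (by
            have : 1 ≤ Real.exp (1:ℝ) := Real.one_le_exp zero_le_one
            nlinarith) ?_ i) (Real.exp_pos _).le
          have he : Real.exp (1 : ℝ) - 1 ≤ 2 := by have := Real.exp_one_lt_three; linarith
          calc 1 + ρ * (Real.exp 1 - 1) ≤ 1 + ρ * 2 := by nlinarith
            _ = 2 * ρ + 1 := by ring
            _ ≤ Real.exp (2 * ρ) := Real.add_one_le_exp _
      _ = Real.exp (-max (α * i) (M / β) + 2 * ρ * i) := by
          rw [← Real.exp_nat_mul, ← Real.exp_add]; ring_nf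
      _ ≤ Real.exp (-(M / (2 * β))) := by
          refine Real.exp_le_exp.2 ?_
          have h1 : 2 * ρ * i ≤ max (α * i) (M / β) / 2 := by
            have : 2 * ρ * i ≤ α * i / 2 := by
              have hi0 : (0 : ℝ) ≤ i := Nat.cast_nonneg _
              nlinarith
            linarith
          have h2 : M / (2 * β) = (M / β) / 2 := by rw [div_div, mul_comm]
          rw [h2]
          linarith
  -- the geometric sum for the first family
  have hsumA : ∑ i ∈ Finset.range (G + 1), μ.real (Aev i) ≤ 8 / μ₀ * Real.exp (-(M : ℝ)) := by
    set r : ℝ := Real.exp (-(μ₀ / 4)) with hr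
    have hr0 : 0 ≤ r := (Real.exp_pos _).le
    have hr1 : r < 1 := Real.exp_lt_one_iff.2 (by linarith)
    set i₀ : ℕ := ⌈(M : ℝ) / θ⌉₊ with hi₀
    have hterm : ∀ i ∈ Finset.range (G + 1),
        μ.real (Aev i) ≤ if i ∈ Finset.Ico i₀ (G + 1) then r ^ i else 0 := by
      intro i hi
      refine (hA i).trans ?_
      by_cases hMi : (M : ℝ) ≤ θ * i
      · have hii : i ∈ Finset.Ico i₀ (G + 1) := by
          refine Finset.mem_Ico.2 ⟨Nat.ceil_le.2 ?_, Finset.mem_range.1 hi⟩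
          rwa [div_le_iff₀' hθ0]
        rw [if_pos hMi, if_pos hii, hr, ← Real.exp_nat_mul]
        ring_nf; rfl
      · rw [if_neg hMi]
        split_ifs
        · exact pow_nonneg hr0 _
        · exact le_rfl
    calc ∑ i ∈ Finset.range (G + 1), μ.real (Aev i)
        ≤ ∑ i ∈ Finset.range (G + 1), (if i ∈ Finset.Ico i₀ (G + 1) then r ^ i else 0) := Finset.sum_le_sum hterm
      _ = ∑ i ∈ Finset.Ico i₀ (G + 1), r ^ i := by
          rw [← Finset.sum_filter]
          congr 1
          ext i
          simp only [Finset.mem_filter, Finset.mem_range, Finset.mem_Ico]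
          omega
      _ ≤ r ^ i₀ / (1 - r) := geom_sum_Ico_le_of_lt_one hr0 hr1
      _ ≤ Real.exp (-(M : ℝ)) / (μ₀ / 8) := by
          have h1 : r ^ i₀ ≤ Real.exp (-(M : ℝ)) := by
            rw [hr, ← Real.exp_nat_mul]
            refine Real.exp_le_exp.2 ?_
            have hi0 : (M : ℝ) / θ ≤ i₀ := Nat.le_ceil _
            rw [div_le_iff₀ hθ0, hθ] at hi0
            nlinarith
          have h2 : μ₀ / 8 ≤ 1 - r := by
            have := half_le_one_sub_exp_neg (x := μ₀ / 4) (by positivity) (by linarith)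
            rw [hr]; linarith
          exact div_le_div₀ (Real.exp_pos _).le h1 (by positivity) h2
      _ = 8 / μ₀ * Real.exp (-(M : ℝ)) := by field_simp
  -- assemble
  calc μ.real {ω | M ≤ boundaryConnCount d j ω ∧ boundaryConnCount d j ω ≤ 2 ^ d * s ^ 2 * shiftBadCount d p j s w ω}
      ≤ μ.real ((⋃ i ∈ Finset.range (G + 1), Aev i) ∪ ⋃ i ∈ Finset.range (G + 1), Bev i) :=
        measureReal_mono hcover (measure_ne_top _ _)
    _ ≤ μ.real (⋃ i ∈ Finset.range (G + 1), Aev i) + μ.real (⋃ i ∈ Finset.range (G + 1), Bev i) :=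
        measureReal_union_le _ _
    _ ≤ ∑ i ∈ Finset.range (G + 1), μ.real (Aev i) + ∑ i ∈ Finset.range (G + 1), μ.real (Bev i) :=
        add_le_add (measureReal_biUnion_finset_le _ _) (measureReal_biUnion_finset_le _ _)
    _ ≤ 8 / μ₀ * Real.exp (-(M : ℝ)) + ∑ _i ∈ Finset.range (G + 1), Real.exp (-(M / (2 * β))) :=
        add_le_add hsumA (Finset.sum_le_sum fun i _ => hB i)
    _ = 8 / μ₀ * Real.exp (-(M : ℝ)) + (G + 1) * Real.exp (-(M / (2 * β))) := by
        rw [Finset.sum_const, Finset.card_range, nsmul_eq_mul]; push_cast; ring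

end OneShift

/-! ### The two estimates for one scale `s`, and the union over scales -/

section Scales

/-- **The bad-scale event** `F_s = {M ≤ X_j ≤ s² X_j^{s-loc-bad}}`. [cite: KozmaNachmias2011, proof of Theorem 5 (p. 396)] -/
def badScaleEvent (d : ℕ) (p : unitInterval) (j s M : ℕ) : Set (BondConfig (Site d)) :=
  {ω | M ≤ boundaryConnCount d j ω ∧ boundaryConnCount d j ω ≤ s ^ 2 * locBadBoundaryConnCount d p j s ω}

/-- `|gridPts| ≤ (2j + 4S + 1)^d`. [folklore] -/
theorem card_gridPts_le (j S : ℕ) (w : Site d) : #(gridPts j S w) ≤ (2 * (j + 2 * S) + 1) ^ d :=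
  (Finset.card_le_card (Finset.filter_subset _ _)).trans (card_box d (j + 2 * S)).le

/-- **The exploration estimate for one scale** (Kozma–Nachmias 2011, proof of Theorem 5, summed
over the `2^d` shifts): under the hypotheses of `real_shiftEvent_le`,
`P(F_s) ≤ 2^d ((8/μ₀) e^{-M} + ((2j+4S+1)^d + 1) e^{-M/(2β)})`.
[cite: KozmaNachmias2011, proof of Theorem 5 (pp. 396–397)] -/
theorem real_badScaleEvent_le_main (hd : 1 ≤ d) (p : unitInterval) {j s : ℕ} (hs : 1 ≤ s)
    (hj : 4 * locScale d s < j) {μ₀ ρ₁ : ℝ} (hμ0 : 0 < μ₀) (hμ1 : μ₀ ≤ 1) (hρ0 : 0 ≤ ρ₁)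
    (hcor : ∀ (x : Site d), (∃ w' ∈ sphere d j, w' - x ∈ box d (2 * locScale d s)) → ∀ y ∈ box d j,
      y - x ∈ box d (2 * locScale d s) → μ₀ ≤ (bondPercolation (zdGraph d) p).real
        {ω | ∃ w' ∈ sphere d j, ω ∈ openConnIn
          (↑((box d j).filter fun u => u - x ∈ box d (2 * locScale d s)) : Set (Site d)) y w'})
    (hρ : ∀ x : Site d, (bondPercolation (zdGraph d) p).real {ω | IsSLocBad p j s x ω} ≤ ρ₁)
    (hcond : 16 * (2 ^ d * (s : ℝ) ^ 2 * (4 * locScale d s + 1 : ℝ) ^ d) * ((4 * locScale d s + 1 : ℝ) ^ d * ρ₁) ≤ μ₀)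
    (M : ℕ) :
    (bondPercolation (zdGraph d) p).real (badScaleEvent d p j s M) ≤
      2 ^ d * (8 / μ₀ * Real.exp (-(M : ℝ)) +
        ((2 * (j + 2 * locScale d s) + 1 : ℝ) ^ d + 1) *
          Real.exp (-(M / (2 * (2 ^ d * (s : ℝ) ^ 2 * (4 * locScale d s + 1 : ℝ) ^ d))))) := by
  set μ := bondPercolation (zdGraph d) p with hμ
  set W := shiftSet d (locScale d s) with hW
  set T : ℝ := 8 / μ₀ * Real.exp (-(M : ℝ)) +
    ((2 * (j + 2 * locScale d s) + 1 : ℝ) ^ d + 1) *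
      Real.exp (-(M / (2 * (2 ^ d * (s : ℝ) ^ 2 * (4 * locScale d s + 1 : ℝ) ^ d)))) with hT
  have hsub : badScaleEvent d p j s M ⊆ ⋃ w ∈ W,
      {ω | M ≤ boundaryConnCount d j ω ∧ boundaryConnCount d j ω ≤ 2 ^ d * s ^ 2 * shiftBadCount d p j s w ω} := by
    rintro ω ⟨hM, hX⟩
    obtain ⟨w, hw, hle⟩ := exists_shift_of_le p hX
    exact Set.mem_biUnion (Finset.mem_coe.2 hw) ⟨hM, hle⟩
  have hw : ∀ w ∈ W, μ.real {ω | M ≤ boundaryConnCount d j ω ∧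
      boundaryConnCount d j ω ≤ 2 ^ d * s ^ 2 * shiftBadCount d p j s w ω} ≤ T := by
    intro w _
    refine (real_shiftEvent_le hd p hs hj w hμ0 hμ1 hρ0 hcor hρ hcond M).trans ?_
    rw [hT]
    refine add_le_add le_rfl (mul_le_mul_of_nonneg_right ?_ (Real.exp_pos _).le)
    refine add_le_add ?_ le_rfl
    exact_mod_cast card_gridPts_le j (locScale d s) w
  have hT0 : 0 ≤ T := le_trans measureReal_nonneg (hw _ (shiftSet_nonempty d _).choose_spec)
  calc μ.real (badScaleEvent d p j s M)
      ≤ μ.real (⋃ w ∈ W, {ω | M ≤ boundaryConnCount d j ω ∧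
          boundaryConnCount d j ω ≤ 2 ^ d * s ^ 2 * shiftBadCount d p j s w ω}) := measureReal_mono hsub (measure_ne_top _ _)
    _ ≤ ∑ w ∈ W, μ.real {ω | M ≤ boundaryConnCount d j ω ∧
          boundaryConnCount d j ω ≤ 2 ^ d * s ^ 2 * shiftBadCount d p j s w ω} := measureReal_biUnion_finset_le _ _
    _ ≤ ∑ _w ∈ W, T := Finset.sum_le_sum hw
    _ = #W * T := by rw [Finset.sum_const, nsmul_eq_mul]
    _ ≤ 2 ^ d * T := mul_le_mul_of_nonneg_right (by exact_mod_cast card_shiftSet_le d _) hT0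

/-- **The crude estimate for one scale** (Kozma–Nachmias 2011, proof of Theorem 5, (4.8): "for
`s > s₀` we use a much simpler estimate directly using Lemma 4.3"): for `M ≥ 1`,
`P(F_s) ≤ P(X_j^{s-loc-bad} ≥ 1) ≤ |∂Q_j| · sup_x P(x is s-locally-bad)`.
[cite: KozmaNachmias2011, proof of Theorem 5, (4.8) (p. 397)] -/
theorem real_badScaleEvent_le_crude (p : unitInterval) (j s : ℕ) {ρ₁ : ℝ}
    (hρ : ∀ x : Site d, (bondPercolation (zdGraph d) p).real {ω | IsSLocBad p j s x ω} ≤ ρ₁) {M : ℕ} (hM : 1 ≤ M) :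
    (bondPercolation (zdGraph d) p).real (badScaleEvent d p j s M) ≤ #(sphere d j) * ρ₁ := by
  classical
  set μ := bondPercolation (zdGraph d) p with hμ
  have hsub : badScaleEvent d p j s M ⊆ ⋃ x ∈ sphere d j, {ω | IsSLocBad p j s x ω} := by
    rintro ω ⟨hMX, hX⟩
    have hpos : 0 < locBadBoundaryConnCount d p j s ω := by
      by_contra h0
      push Not at h0
      have : locBadBoundaryConnCount d p j s ω = 0 := by omega
      rw [this, mul_zero] at hX
      omega
    obtain ⟨x, hx⟩ := Finset.card_pos.1 hpos
    obtain ⟨hxS, -, hbad⟩ := Finset.mem_filter.1 hx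
    exact Set.mem_biUnion (Finset.mem_coe.2 hxS) hbad
  calc μ.real (badScaleEvent d p j s M) ≤ μ.real (⋃ x ∈ sphere d j, {ω | IsSLocBad p j s x ω}) :=
        measureReal_mono hsub (measure_ne_top _ _)
    _ ≤ ∑ x ∈ sphere d j, μ.real {ω | IsSLocBad p j s x ω} := measureReal_biUnion_finset_le _ _
    _ ≤ ∑ _x ∈ sphere d j, ρ₁ := Finset.sum_le_sum fun x _ => hρ x
    _ = #(sphere d j) * ρ₁ := by rw [Finset.sum_const, nsmul_eq_mul]

/-- **The union over the scales** (Kozma–Nachmias 2011, proof of Theorem 5: "the theorem will be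
proved once we get a good estimate of `P(X_j ≥ M and X_j^{s-loc-bad} ≥ X_j/s²)` by taking a union
bound over all `s`"): the event of Theorem 5, `{M ≤ X_j ≤ 2 X_j^{K-loc-irr}}`, lies in
`⋃_{s ≥ K} F_s` (`K ≥ 3`). [cite: KozmaNachmias2011, proof of Theorem 5 (p. 396)] -/
theorem thm5Event_subset_iUnion (p : unitInterval) {j K M : ℕ} (hK : 3 ≤ K) :
    {ω : BondConfig (Site d) | M ≤ boundaryConnCount d j ω ∧
        boundaryConnCount d j ω ≤ 2 * locIrrBoundaryConnCount d p j K ω} ⊆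
      ⋃ s : ℕ, if K ≤ s then badScaleEvent d p j s M else ∅ := by
  rintro ω ⟨hM, hX⟩
  obtain ⟨s, hKs, hs⟩ := exists_sq_mul_locBad_ge p hK hX
  refine Set.mem_iUnion.2 ⟨s, ?_⟩
  rw [if_pos hKs]
  exact ⟨hM, hs⟩

/-- **Countable union bound with a partial-sum majorant**: if `E ⊆ ⋃_s F_s`, `P(F_s) ≤ b_s` with
`b ≥ 0` and all partial sums of `b` are at most `c`, then `P(E) ≤ c`. [folklore] -/
theorem measureReal_le_of_subset_iUnion {μ : Measure (BondConfig (Site d))} [IsFiniteMeasure μ]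
    {E : Set (BondConfig (Site d))} {F : ℕ → Set (BondConfig (Site d))} (hE : E ⊆ ⋃ s, F s) {b : ℕ → ℝ}
    (hb0 : ∀ s, 0 ≤ b s) (hFb : ∀ s, μ.real (F s) ≤ b s) {c : ℝ} (hc : ∀ n, ∑ s ∈ Finset.range n, b s ≤ c) :
    μ.real E ≤ c := by
  have hc0 : 0 ≤ c := by simpa using hc 0
  have hsum : Summable b := summable_of_sum_range_le hb0 hc
  have htsum : ∑' s, b s ≤ c := Real.tsum_le_of_sum_range_le hb0 hc
  rw [measureReal_def]
  refine ENNReal.toReal_le_of_le_ofReal hc0 ?_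
  calc μ E ≤ μ (⋃ s, F s) := measure_mono hE
    _ ≤ ∑' s, μ (F s) := measure_iUnion_le _
    _ ≤ ∑' s, ENNReal.ofReal (b s) := ENNReal.tsum_le_tsum fun s => by
        rw [← ENNReal.ofReal_toReal (measure_ne_top μ (F s))]
        exact ENNReal.ofReal_le_ofReal (hFb s)
    _ = ENNReal.ofReal (∑' s, b s) := (ENNReal.ofReal_tsum_of_nonneg hb0 hsum).symm
    _ ≤ ENNReal.ofReal c := ENNReal.ofReal_le_ofReal htsum

/-- Uniform bound on the partial sums of `e^{-a log⁴ s}`: for `s ≥ s_a = ⌈e^{max(1, 2/a)}⌉` the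
terms are at most `s^{-2}`. [folklore] -/
theorem sum_exp_neg_log_pow_four_le {a : ℝ} (ha : 0 < a) (n : ℕ) :
    ∑ s ∈ Finset.range n, Real.exp (-(a * Real.log s ^ 4)) ≤ ⌈Real.exp (max 1 (2 / a))⌉₊ + 2 := by
  set sa : ℕ := ⌈Real.exp (max 1 (2 / a))⌉₊ with hsa
  have hsa2 : 2 ≤ sa := by
    have : (2 : ℝ) ≤ Real.exp (max 1 (2 / a)) := by
      have h1 : (1 : ℝ) ≤ max 1 (2 / a) := le_max_left _ _
      have := Real.add_one_le_exp (max 1 (2 / a)); linarith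
    exact_mod_cast this.trans (Nat.le_ceil _)
  -- terms are at most one, and at most `s^{-2}` beyond `sa`
  have hle1 : ∀ s : ℕ, Real.exp (-(a * Real.log s ^ 4)) ≤ 1 := fun s =>
    Real.exp_le_one_iff.2 (neg_nonpos.2 (by positivity))
  have hle2 : ∀ s : ℕ, sa ≤ s → Real.exp (-(a * Real.log s ^ 4)) ≤ ((s : ℝ) ^ 2)⁻¹ := by
    intro s hs
    have hs0 : (0 : ℝ) < s := by exact_mod_cast (show 0 < s by omega)
    have hlog : max 1 (2 / a) ≤ Real.log s := by
      rw [Real.le_log_iff_exp_le hs0]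
      exact (Nat.le_ceil _).trans (by exact_mod_cast hs)
    have hl1 : 1 ≤ Real.log s := le_trans (le_max_left _ _) hlog
    have hl2 : 2 / a ≤ Real.log s := le_trans (le_max_right _ _) hlog
    have hal : 2 ≤ a * Real.log s := by rwa [div_le_iff₀' ha] at hl2
    rw [← Real.exp_log (pow_pos hs0 2), ← Real.exp_neg, Real.log_pow]
    refine Real.exp_le_exp.2 (neg_le_neg ?_)
    have hl3 : Real.log s ≤ Real.log s ^ 3 := by
      calc Real.log s = Real.log s * 1 := (mul_one _).symm
        _ ≤ Real.log s * Real.log s ^ 2 := mul_le_mul_of_nonneg_left (one_le_pow₀ hl1) (by linarith)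
        _ = Real.log s ^ 3 := by ring
    calc ((2 : ℕ) : ℝ) * Real.log s = 2 * Real.log s := by norm_num
      _ ≤ (a * Real.log s) * Real.log s := mul_le_mul_of_nonneg_right hal (by linarith)
      _ ≤ (a * Real.log s) * Real.log s ^ 3 := mul_le_mul_of_nonneg_left hl3 (by positivity)
      _ = a * Real.log s ^ 4 := by ring
  -- split the range at `sa`
  have hsplit : ∀ n, ∑ s ∈ Finset.range n, Real.exp (-(a * Real.log s ^ 4)) ≤
      ∑ s ∈ Finset.range sa, Real.exp (-(a * Real.log s ^ 4)) + ∑ s ∈ Finset.Ico sa n, ((s : ℝ) ^ 2)⁻¹ := by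
    intro n
    by_cases hn : n ≤ sa
    · calc ∑ s ∈ Finset.range n, Real.exp (-(a * Real.log s ^ 4))
          ≤ ∑ s ∈ Finset.range sa, Real.exp (-(a * Real.log s ^ 4)) :=
            Finset.sum_le_sum_of_subset_of_nonneg (Finset.range_mono hn) fun s _ _ => (Real.exp_pos _).le
        _ ≤ _ := le_add_of_nonneg_right (Finset.sum_nonneg fun s _ => by positivity)
    · push Not at hn
      rw [Finset.range_eq_Ico, ← Finset.Ico_union_Ico_eq_Ico (Nat.zero_le sa) hn.le,
        Finset.sum_union (Finset.Ico_disjoint_Ico_consecutive 0 sa n), ← Finset.range_eq_Ico]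
      exact add_le_add le_rfl (Finset.sum_le_sum fun s hs => hle2 s (Finset.mem_Ico.1 hs).1)
  refine (hsplit n).trans (add_le_add ?_ ?_)
  · calc ∑ s ∈ Finset.range sa, Real.exp (-(a * Real.log s ^ 4)) ≤ ∑ _s ∈ Finset.range sa, (1 : ℝ) :=
          Finset.sum_le_sum fun s _ => hle1 s
      _ = sa := by simp
  · calc ∑ s ∈ Finset.Ico sa n, ((s : ℝ) ^ 2)⁻¹ ≤ ((sa : ℝ) - 1)⁻¹ :=
          sum_inv_sq_le hsa2 fun s hs => (Finset.mem_Ico.1 hs).1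
      _ ≤ 2 := by
          have : (2 : ℝ) ≤ sa := by exact_mod_cast hsa2
          rw [inv_le_comm₀ (by linarith) two_pos]
          linarith

end Scales

/-! ### The arithmetic of the proof of Theorem 5 -/

section Arith

/-- `(4S+1) ≤ 5S` and `S = s^{4d²}` as real numbers. [folklore] -/
theorem cast_locScale (d s : ℕ) : ((locScale d s : ℕ) : ℝ) = (s : ℝ) ^ (4 * d ^ 2) := by
  rw [locScale]; push_cast; rfl

/-- **The condition `16 β (4S+1)^d ρ₁ ≤ μ₀` for large `s`** (the choice "we fix `K` sufficiently
large so that any `s ≥ K` will satisfy the requirement on `μ`", proof of Theorem 5): it holds as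
soon as `log s ≥ L₁`, an explicit linear threshold in the constants of Lemma 4.3 and
Corollary 3.2. [cite: KozmaNachmias2011, proof of Theorem 5 (p. 397)] -/
theorem thm5_cond {d : ℕ} (hd : 1 ≤ d) {c43 C43 c' Cc : ℝ} (hc43 : 0 < c43) (hC43 : 0 < C43) (hc' : 0 < c')
    (hCc : 0 < Cc) {s : ℕ} (hs : 2 ≤ s)
    (hL : max 1 ((3 * max (Real.log (16 * 50 ^ d * C43 / c')) 0 + 3 * (2 + 8 * (d : ℝ) ^ 3) + 75 * Cc * (d : ℝ) ^ 4) / c43) ≤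
      Real.log s) :
    16 * (2 ^ d * (s : ℝ) ^ 2 * (4 * locScale d s + 1 : ℝ) ^ d) *
        ((4 * locScale d s + 1 : ℝ) ^ d * (C43 * Real.exp (-(c43 * Real.log s ^ 4)))) ≤
      c' * Real.exp (-Cc * Real.log ↑(2 * locScale d s) ^ 2) := by
  set L := Real.log s with hLdef
  have hs0 : (0 : ℝ) < s := by exact_mod_cast (show 0 < s by omega)
  have hL1 : 1 ≤ L := le_trans (le_max_left _ _) hL
  have hL0 : 0 ≤ L := by linarith
  have hd1 : (1 : ℝ) ≤ d := by exact_mod_cast hd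
  set S : ℝ := ((locScale d s : ℕ) : ℝ) with hSdef
  have hS : S = (s : ℝ) ^ (4 * d ^ 2) := cast_locScale d s
  have hS1 : 1 ≤ S := by rw [hS]; exact one_le_pow₀ (by exact_mod_cast (show 1 ≤ s by omega))
  have hSpos : 0 < S := by linarith
  -- the left-hand side as an exponential
  have h5S : (4 * S + 1) ≤ 5 * S := by linarith
  have hspow : ∀ n : ℕ, (s : ℝ) ^ n = Real.exp (n * L) := fun n => by
    rw [Real.exp_nat_mul, hLdef, Real.exp_log hs0]
  have hLHS : 16 * (2 ^ d * (s : ℝ) ^ 2 * (4 * S + 1) ^ d) * ((4 * S + 1) ^ d * (C43 * Real.exp (-(c43 * L ^ 4)))) ≤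
      (16 * 50 ^ d * C43) * Real.exp ((2 + 8 * (d : ℝ) ^ 3) * L - c43 * L ^ 4) := by
    have h1 : (4 * S + 1) ^ d ≤ (5 * S) ^ d := pow_le_pow_left₀ (by linarith) h5S d
    have h2 : (s : ℝ) ^ 2 * (5 * S) ^ d * (5 * S) ^ d = 25 ^ d * Real.exp ((2 + 8 * (d : ℝ) ^ 3) * L) := by
      rw [mul_pow, hS, ← pow_mul, show (25 : ℝ) ^ d = 5 ^ d * 5 ^ d by rw [← mul_pow]; norm_num]
      have : (s : ℝ) ^ 2 * ((s : ℝ) ^ (4 * d ^ 2 * d)) * ((s : ℝ) ^ (4 * d ^ 2 * d)) = (s : ℝ) ^ (2 + 8 * d ^ 3) := by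
        rw [← pow_add, ← pow_add]; congr 1; ring
      calc (s : ℝ) ^ 2 * (5 ^ d * (s : ℝ) ^ (4 * d ^ 2 * d)) * (5 ^ d * (s : ℝ) ^ (4 * d ^ 2 * d))
          = 5 ^ d * 5 ^ d * ((s : ℝ) ^ 2 * (s : ℝ) ^ (4 * d ^ 2 * d) * (s : ℝ) ^ (4 * d ^ 2 * d)) := by ring
        _ = 5 ^ d * 5 ^ d * Real.exp ((2 + 8 * (d : ℝ) ^ 3) * L) := by rw [this, hspow]; push_cast; ring_nf
    calc 16 * (2 ^ d * (s : ℝ) ^ 2 * (4 * S + 1) ^ d) * ((4 * S + 1) ^ d * (C43 * Real.exp (-(c43 * L ^ 4))))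
        = 16 * 2 ^ d * C43 * ((s : ℝ) ^ 2 * (4 * S + 1) ^ d * (4 * S + 1) ^ d) * Real.exp (-(c43 * L ^ 4)) := by ring
      _ ≤ 16 * 2 ^ d * C43 * ((s : ℝ) ^ 2 * (5 * S) ^ d * (5 * S) ^ d) * Real.exp (-(c43 * L ^ 4)) := by
          gcongr
      _ = (16 * 50 ^ d * C43) * Real.exp ((2 + 8 * (d : ℝ) ^ 3) * L - c43 * L ^ 4) := by
          rw [h2, sub_eq_add_neg, Real.exp_add, show (50 : ℝ) ^ d = 2 ^ d * 25 ^ d by rw [← mul_pow]; norm_num]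
          ring
  -- the right-hand side from below
  have hlog2S : Real.log ↑(2 * locScale d s) ≤ 5 * (d : ℝ) ^ 2 * L := by
    have h2S : ((2 * locScale d s : ℕ) : ℝ) = 2 * S := by push_cast; rw [hSdef]
    rw [h2S, Real.log_mul two_ne_zero hSpos.ne', hS, Real.log_pow]
    have hlog2 : Real.log 2 ≤ (d : ℝ) ^ 2 * L := by
      have h2 : Real.log 2 ≤ 1 := by
        have := Real.add_one_le_exp (1 : ℝ)
        rw [Real.log_le_iff_le_exp two_pos]; linarith
      calc Real.log 2 ≤ 1 := h2
        _ = 1 * 1 := (mul_one _).symm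
        _ ≤ (d : ℝ) ^ 2 * L := mul_le_mul (one_le_pow₀ hd1) hL1 zero_le_one (by positivity)
    have hd2L : 0 ≤ (d : ℝ) ^ 2 * L := by positivity
    push_cast
    linarith
  have hlog2S0 : 0 ≤ Real.log ↑(2 * locScale d s) := Real.log_natCast_nonneg _
  have hRHS : c' * Real.exp (-(25 * Cc * (d : ℝ) ^ 4 * L ^ 2)) ≤ c' * Real.exp (-Cc * Real.log ↑(2 * locScale d s) ^ 2) := by
    refine mul_le_mul_of_nonneg_left (Real.exp_le_exp.2 ?_) hc'.le
    have h1 : Real.log ↑(2 * locScale d s) ^ 2 ≤ (5 * (d : ℝ) ^ 2 * L) ^ 2 := pow_le_pow_left₀ hlog2S0 hlog2S 2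
    have h2 : Cc * Real.log ↑(2 * locScale d s) ^ 2 ≤ Cc * (5 * (d : ℝ) ^ 2 * L) ^ 2 := mul_le_mul_of_nonneg_left h1 hCc.le
    have h3 : Cc * (5 * (d : ℝ) ^ 2 * L) ^ 2 = 25 * Cc * (d : ℝ) ^ 4 * L ^ 2 := by ring
    linarith
  -- comparison of the exponents
  set Q : ℝ := 16 * 50 ^ d * C43 / c' with hQ
  have hQ0 : 0 < Q := by positivity
  have hkey : Real.log Q + (2 + 8 * (d : ℝ) ^ 3) * L + 25 * Cc * (d : ℝ) ^ 4 * L ^ 2 ≤ c43 * L ^ 4 := by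
    have hcL : 3 * max (Real.log Q) 0 + 3 * (2 + 8 * (d : ℝ) ^ 3) + 75 * Cc * (d : ℝ) ^ 4 ≤ c43 * L := by
      have := le_trans (le_max_right _ _) hL
      rw [div_le_iff₀ hc43] at this
      linarith
    set m := max (Real.log Q) 0 with hm'
    set b : ℝ := 2 + 8 * (d : ℝ) ^ 3 with hb'
    set c : ℝ := Cc * (d : ℝ) ^ 4 with hc'
    have hm : Real.log Q ≤ m := le_max_left _ _
    have hm0 : 0 ≤ m := le_max_right _ _
    have hb0 : 0 ≤ b := by positivity
    have hc0 : 0 ≤ c := by positivity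
    have hL3 : 1 ≤ L ^ 3 := one_le_pow₀ hL1
    have hLL3 : L ≤ L ^ 3 := by
      calc L = L * 1 := (mul_one L).symm
        _ ≤ L * L ^ 2 := mul_le_mul_of_nonneg_left (one_le_pow₀ hL1) hL0
        _ = L ^ 3 := by ring
    have hL2L3 : L ^ 2 ≤ L ^ 3 := by
      calc L ^ 2 = L ^ 2 * 1 := (mul_one _).symm
        _ ≤ L ^ 2 * L := mul_le_mul_of_nonneg_left hL1 (by positivity)
        _ = L ^ 3 := by ring
    have h1 : (3 * m + 3 * b + 75 * c) * L ^ 3 ≤ c43 * L ^ 4 := by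
      have hcL' : 3 * m + 3 * b + 75 * c ≤ c43 * L := by rw [hc']; linarith
      calc _ ≤ (c43 * L) * L ^ 3 := mul_le_mul_of_nonneg_right hcL' (by positivity)
        _ = c43 * L ^ 4 := by ring
    have hmL3 : 0 ≤ m * L ^ 3 := mul_nonneg hm0 (zero_le_one.trans hL3)
    have h2 : Real.log Q ≤ 3 * m * L ^ 3 := by
      have h21 : m ≤ m * L ^ 3 := by
        calc m = m * 1 := (mul_one m).symm
          _ ≤ m * L ^ 3 := mul_le_mul_of_nonneg_left hL3 hm0
      linarith
    have hbL3 : 0 ≤ b * L ^ 3 := mul_nonneg hb0 (zero_le_one.trans hL3)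
    have h3 : b * L ≤ 3 * b * L ^ 3 := by
      have h31 : b * L ≤ b * L ^ 3 := mul_le_mul_of_nonneg_left hLL3 hb0
      linarith
    have hcL3 : 0 ≤ c * L ^ 3 := mul_nonneg hc0 (zero_le_one.trans hL3)
    have h4 : 25 * Cc * (d : ℝ) ^ 4 * L ^ 2 ≤ 75 * c * L ^ 3 := by
      have h41 : c * L ^ 2 ≤ c * L ^ 3 := mul_le_mul_of_nonneg_left hL2L3 hc0
      have h42 : 25 * Cc * (d : ℝ) ^ 4 * L ^ 2 = 25 * (c * L ^ 2) := by rw [hc']; ring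
      rw [h42]
      linarith
    calc Real.log Q + (2 + 8 * (d : ℝ) ^ 3) * L + 25 * Cc * (d : ℝ) ^ 4 * L ^ 2
        = Real.log Q + b * L + 25 * Cc * (d : ℝ) ^ 4 * L ^ 2 := by rw [hb']
      _ ≤ 3 * m * L ^ 3 + 3 * b * L ^ 3 + 75 * c * L ^ 3 := by linarith
      _ = (3 * m + 3 * b + 75 * c) * L ^ 3 := by ring
      _ ≤ c43 * L ^ 4 := h1
  calc 16 * (2 ^ d * (s : ℝ) ^ 2 * (4 * S + 1) ^ d) * ((4 * S + 1) ^ d * (C43 * Real.exp (-(c43 * L ^ 4))))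
      ≤ (16 * 50 ^ d * C43) * Real.exp ((2 + 8 * (d : ℝ) ^ 3) * L - c43 * L ^ 4) := hLHS
    _ = c' * (Q * Real.exp ((2 + 8 * (d : ℝ) ^ 3) * L - c43 * L ^ 4)) := by rw [hQ]; field_simp
    _ = c' * Real.exp (Real.log Q + ((2 + 8 * (d : ℝ) ^ 3) * L - c43 * L ^ 4)) := by
        rw [Real.exp_add, Real.exp_log hQ0]
    _ ≤ c' * Real.exp (-(25 * Cc * (d : ℝ) ^ 4 * L ^ 2)) :=
        mul_le_mul_of_nonneg_left (Real.exp_le_exp.2 (by linarith)) hc'.le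
    _ ≤ c' * Real.exp (-Cc * Real.log ↑(2 * locScale d s) ^ 2) := hRHS

/-- **The arithmetic of the sum over the scales** (proof of Theorem 5, (4.7)–(4.8)): with
`ℓ = log M` beyond explicit thresholds, `s₀ ≤ e^{κℓ}`, `κ = 1/(16 d³ (2 + 4d³))`, and
`log j ≥ (ℓ - log A')/(d-1)`, the two partial sums are at most `C j^d e^{-c ℓ²}`. [folklore] -/
theorem thm5_arith {d : ℕ} {c43 C43 c' Cc A' ℓ κ cfin : ℝ} {j s₀ Z : ℕ}
    (hc43 : 0 < c43) (hC43 : 0 < C43) (hc' : 0 < c') (hCc : 0 < Cc) (hA' : 0 < A')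
    (hκ0 : 0 < κ) (hκ1 : κ ≤ 1) (hcfin1 : cfin ≤ 1) (hcfinκ : cfin ≤ c43 / 2 * κ ^ 4)
    (hj1 : 1 ≤ j) (hℓ1 : 1 ≤ ℓ) (hℓa : 24 * (4 * Cc + 2) ≤ ℓ) (hℓb : 184320 * 10 ^ d ≤ ℓ)
    (hs₀ : (s₀ : ℝ) ≤ Real.exp (κ * ℓ)) :
    s₀ * (2 ^ d * (8 / c' * Real.exp (4 * Cc * ℓ ^ 2) * Real.exp (-Real.exp ℓ) +
        ((4 * (j : ℝ)) ^ d + 1) * Real.exp (-(Real.exp ℓ / (2 * 10 ^ d * Real.exp (ℓ / 2)))))) +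
      A' * (j : ℝ) ^ (d - 1) * C43 * Real.exp (-(c43 / 2 * κ ^ 4 * ℓ ^ 4)) * Z ≤
      (2 ^ d * (8 / c' + 4 ^ d + 1) + A' * C43 * Z) * (j : ℝ) ^ d * Real.exp (-(cfin * ℓ ^ 2)) := by
  have hℓ0 : 0 ≤ ℓ := by linarith
  have hj1r : (1 : ℝ) ≤ j := by exact_mod_cast hj1
  have hjd : (j : ℝ) ^ (d - 1) ≤ (j : ℝ) ^ d := pow_le_pow_right₀ hj1r (Nat.sub_le d 1)
  have hjd1 : 1 ≤ (j : ℝ) ^ d := one_le_pow₀ hj1r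
  set E : ℝ := Real.exp (-(cfin * ℓ ^ 2)) with hE
  have hE0 : 0 < E := Real.exp_pos _
  have hEℓ : Real.exp (-ℓ ^ 2) ≤ E := by rw [hE]; exact Real.exp_le_exp.2 (by nlinarith)
  -- `e^{ℓ} ≥ ℓ⁴/24` and `e^{ℓ/2} ≥ (ℓ/2)⁶/720`
  have hM4 : ℓ ^ 4 / 24 ≤ Real.exp ℓ := by
    have := Real.pow_div_factorial_le_exp ℓ hℓ0 4
    norm_num [Nat.factorial] at this; linarith
  have hM6 : (ℓ / 2) ^ 6 / 720 ≤ Real.exp (ℓ / 2) := by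
    have := Real.pow_div_factorial_le_exp (ℓ / 2) (by linarith) 6
    norm_num [Nat.factorial] at this; linarith
  -- first piece: `e^{κℓ} e^{4Ccℓ²} e^{-M} ≤ e^{-ℓ²}`
  have hP2 : Real.exp (κ * ℓ) * (Real.exp (4 * Cc * ℓ ^ 2) * Real.exp (-Real.exp ℓ)) ≤ Real.exp (-ℓ ^ 2) := by
    rw [← Real.exp_add, ← Real.exp_add]
    refine Real.exp_le_exp.2 ?_
    have h1 : (4 * Cc + 2) * ℓ ^ 2 ≤ ℓ ^ 4 / 24 := by
      have : 24 * (4 * Cc + 2) ≤ ℓ ^ 2 := by nlinarith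
      nlinarith
    have h2 : κ * ℓ ≤ ℓ ^ 2 := by nlinarith
    nlinarith
  -- second piece: `e^{κℓ} e^{-M/(2·10^d e^{ℓ/2})} ≤ e^{-ℓ²}`
  have hP3 : Real.exp (κ * ℓ) * Real.exp (-(Real.exp ℓ / (2 * 10 ^ d * Real.exp (ℓ / 2)))) ≤ Real.exp (-ℓ ^ 2) := by
    rw [← Real.exp_add]
    refine Real.exp_le_exp.2 ?_
    have hsplit : Real.exp ℓ / (2 * 10 ^ d * Real.exp (ℓ / 2)) = Real.exp (ℓ / 2) / (2 * 10 ^ d) := by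
      have : Real.exp ℓ = Real.exp (ℓ / 2) * Real.exp (ℓ / 2) := by rw [← Real.exp_add]; ring_nf
      rw [this]; field_simp
    rw [hsplit]
    have h10 : (0 : ℝ) < 10 ^ d := by positivity
    have hkey : (ℓ ^ 2 + κ * ℓ) * (2 * 10 ^ d) ≤ Real.exp (ℓ / 2) := by
      refine le_trans ?_ hM6
      have hκℓ : κ * ℓ ≤ ℓ ^ 2 := by nlinarith
      have h1 : (ℓ ^ 2 + κ * ℓ) * (2 * 10 ^ d) ≤ 4 * 10 ^ d * ℓ ^ 2 := by
        have : (ℓ ^ 2 + κ * ℓ) ≤ 2 * ℓ ^ 2 := by linarith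
        calc (ℓ ^ 2 + κ * ℓ) * (2 * 10 ^ d) ≤ (2 * ℓ ^ 2) * (2 * 10 ^ d) := mul_le_mul_of_nonneg_right this (by positivity)
          _ = 4 * 10 ^ d * ℓ ^ 2 := by ring
      have h2 : 4 * 10 ^ d * ℓ ^ 2 ≤ (ℓ / 2) ^ 6 / 720 := by
        have h3 : 184320 * 10 ^ d ≤ ℓ ^ 4 := by
          calc (184320 : ℝ) * 10 ^ d ≤ ℓ := hℓb
            _ ≤ ℓ ^ 4 := by nlinarith [one_le_pow₀ (n := 3) hℓ1]
        have h4 : 4 * 10 ^ d * ℓ ^ 2 * 46080 ≤ ℓ ^ 4 * ℓ ^ 2 := by nlinarith [sq_nonneg ℓ]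
        have h5 : (ℓ / 2) ^ 6 / 720 = ℓ ^ 4 * ℓ ^ 2 / 46080 := by ring
        rw [h5, le_div_iff₀ (by norm_num)]
        linarith
      linarith
    have hge : ℓ ^ 2 + κ * ℓ ≤ Real.exp (ℓ / 2) / (2 * 10 ^ d) := (le_div_iff₀ (by positivity)).2 hkey
    linarith
  -- third piece
  have hP4 : Real.exp (-(c43 / 2 * κ ^ 4 * ℓ ^ 4)) ≤ E := by
    rw [hE]; refine Real.exp_le_exp.2 (neg_le_neg ?_)
    have : ℓ ^ 2 ≤ ℓ ^ 4 := by nlinarith [one_le_pow₀ (n := 2) hℓ1]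
    calc cfin * ℓ ^ 2 ≤ (c43 / 2 * κ ^ 4) * ℓ ^ 2 := mul_le_mul_of_nonneg_right hcfinκ (by positivity)
      _ ≤ (c43 / 2 * κ ^ 4) * ℓ ^ 4 := mul_le_mul_of_nonneg_left this (by positivity)
      _ = _ := by ring
  -- assemble
  have hs₀0 : (0 : ℝ) ≤ s₀ := Nat.cast_nonneg _
  have hT2 : (s₀ : ℝ) * (2 ^ d * (8 / c' * Real.exp (4 * Cc * ℓ ^ 2) * Real.exp (-Real.exp ℓ) +
      ((4 * (j : ℝ)) ^ d + 1) * Real.exp (-(Real.exp ℓ / (2 * 10 ^ d * Real.exp (ℓ / 2)))))) ≤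
      2 ^ d * (8 / c' + 4 ^ d + 1) * (j : ℝ) ^ d * E := by
    have h4j : (4 * (j : ℝ)) ^ d + 1 ≤ (4 ^ d + 1) * (j : ℝ) ^ d := by rw [mul_pow]; nlinarith
    calc (s₀ : ℝ) * (2 ^ d * (8 / c' * Real.exp (4 * Cc * ℓ ^ 2) * Real.exp (-Real.exp ℓ) +
          ((4 * (j : ℝ)) ^ d + 1) * Real.exp (-(Real.exp ℓ / (2 * 10 ^ d * Real.exp (ℓ / 2))))))
        ≤ Real.exp (κ * ℓ) * (2 ^ d * (8 / c' * Real.exp (4 * Cc * ℓ ^ 2) * Real.exp (-Real.exp ℓ) +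
          ((4 ^ d + 1) * (j : ℝ) ^ d) * Real.exp (-(Real.exp ℓ / (2 * 10 ^ d * Real.exp (ℓ / 2)))))) := by
          refine mul_le_mul hs₀ ?_ (by positivity) (Real.exp_pos _).le
          gcongr
      _ = 2 ^ d * (8 / c' * (Real.exp (κ * ℓ) * (Real.exp (4 * Cc * ℓ ^ 2) * Real.exp (-Real.exp ℓ))) +
          (4 ^ d + 1) * (j : ℝ) ^ d * (Real.exp (κ * ℓ) * Real.exp (-(Real.exp ℓ / (2 * 10 ^ d * Real.exp (ℓ / 2)))))) := by
          ring
      _ ≤ 2 ^ d * (8 / c' * E + (4 ^ d + 1) * (j : ℝ) ^ d * E) := by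
          gcongr
          · exact hP2.trans hEℓ
          · exact hP3.trans hEℓ
      _ ≤ 2 ^ d * (8 / c' * ((j : ℝ) ^ d * E) + (4 ^ d + 1) * (j : ℝ) ^ d * E) := by
          gcongr
          exact le_mul_of_one_le_left hE0.le hjd1
      _ = _ := by ring
  have hT1 : A' * (j : ℝ) ^ (d - 1) * C43 * Real.exp (-(c43 / 2 * κ ^ 4 * ℓ ^ 4)) * Z ≤ A' * C43 * Z * (j : ℝ) ^ d * E := by
    have hZ : (0 : ℝ) ≤ Z := Nat.cast_nonneg _
    calc A' * (j : ℝ) ^ (d - 1) * C43 * Real.exp (-(c43 / 2 * κ ^ 4 * ℓ ^ 4)) * Z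
        = A' * C43 * Z * ((j : ℝ) ^ (d - 1) * Real.exp (-(c43 / 2 * κ ^ 4 * ℓ ^ 4))) := by ring
      _ ≤ A' * C43 * Z * ((j : ℝ) ^ d * E) := by
          refine mul_le_mul_of_nonneg_left (mul_le_mul hjd hP4 (Real.exp_pos _).le (by positivity)) (by positivity)
      _ = _ := by ring
  calc _ ≤ 2 ^ d * (8 / c' + 4 ^ d + 1) * (j : ℝ) ^ d * E + A' * C43 * Z * (j : ℝ) ^ d * E := add_le_add hT2 hT1
    _ = (2 ^ d * (8 / c' + 4 ^ d + 1) + A' * C43 * Z) * (j : ℝ) ^ d * E := by ring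

end Arith

/-! ### Theorem 5 and Theorem 4 -/

section Final

/-- `|∂Q_j| ≤ 2d 3^{d-1} j^{d-1}` for `j ≥ 1`. [folklore] -/
theorem card_sphere_le_pow {j : ℕ} (hj : 1 ≤ j) : (#(sphere d j) : ℝ) ≤ 2 * d * 3 ^ (d - 1) * (j : ℝ) ^ (d - 1) := by
  refine (card_sphere_le_two_mul_pow (d := d) hj).trans ?_
  have h1 : (2 * j + 1 : ℝ) ≤ 3 * j := by
    have : (1 : ℝ) ≤ j := by exact_mod_cast hj
    linarith
  calc 2 * (d : ℝ) * (2 * j + 1 : ℝ) ^ (d - 1) ≤ 2 * d * (3 * j : ℝ) ^ (d - 1) := by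
        gcongr
    _ = 2 * d * 3 ^ (d - 1) * (j : ℝ) ^ (d - 1) := by rw [mul_pow]; ring

/-- **The main-regime bound for one scale** `K ≤ s ≤ s₀` (proof of Theorem 5, (4.7)): with
`log s ≤ κ log M`, `4S < j` and the condition of `thm5_cond`, the exploration estimate is at most the
uniform quantity `2^d ((8/c') e^{4C_c ℓ²} e^{-M} + ((4j)^d + 1) e^{-M/(2·10^d e^{ℓ/2})})`, `ℓ = log M`.
[cite: KozmaNachmias2011, proof of Theorem 5, (4.7) (p. 397)] -/
theorem thm5_scale_main (hd1 : 1 ≤ d) (p : unitInterval) {j s M : ℕ} (hj : 1 ≤ j) (hs1 : 1 ≤ s)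
    {c' Cc C43 c43 κ ℓ C₂ : ℝ} (hc'0 : 0 < c') (hc'1 : c' ≤ 1) (hCc : 0 < Cc) (hC43 : 0 < C43)
    (hC₂ : C₂ = 2 + 4 * (d : ℝ) ^ 3) (hC₂κ' : C₂ * κ ≤ 1 / 2) (h4dk1 : 4 * (d : ℝ) ^ 2 * κ ≤ 1)
    (hℓ1 : 1 ≤ ℓ) (hMexp : (M : ℝ) = Real.exp ℓ) (hlogs : Real.log s ≤ κ * ℓ) (h4S : 4 * locScale d s < j)
    (hcor : ∀ (x : Site d), (∃ w' ∈ sphere d j, w' - x ∈ box d (2 * locScale d s)) → ∀ y ∈ box d j,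
      y - x ∈ box d (2 * locScale d s) → c' * Real.exp (-Cc * Real.log ↑(2 * locScale d s) ^ 2) ≤
        (bondPercolation (zdGraph d) p).real {ω | ∃ w' ∈ sphere d j, ω ∈ openConnIn
          (↑((box d j).filter fun u => u - x ∈ box d (2 * locScale d s)) : Set (Site d)) y w'})
    (hρ : ∀ x : Site d, (bondPercolation (zdGraph d) p).real {ω | IsSLocBad p j s x ω} ≤ C43 * Real.exp (-(c43 * Real.log s ^ 4)))
    (hcond : 16 * (2 ^ d * (s : ℝ) ^ 2 * (4 * locScale d s + 1 : ℝ) ^ d) *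
        ((4 * locScale d s + 1 : ℝ) ^ d * (C43 * Real.exp (-(c43 * Real.log s ^ 4)))) ≤
      c' * Real.exp (-Cc * Real.log ↑(2 * locScale d s) ^ 2)) :
    (bondPercolation (zdGraph d) p).real (badScaleEvent d p j s M) ≤
      2 ^ d * (8 / c' * Real.exp (4 * Cc * ℓ ^ 2) * Real.exp (-Real.exp ℓ) +
        ((4 * (j : ℝ)) ^ d + 1) * Real.exp (-(Real.exp ℓ / (2 * 10 ^ d * Real.exp (ℓ / 2))))) := by
  have hs0 : (0 : ℝ) < s := by exact_mod_cast hs1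
  have hℓ0 : 0 ≤ ℓ := by linarith
  have hM0 : (0 : ℝ) < M := by rw [hMexp]; exact Real.exp_pos ℓ
  have hS1 : 1 ≤ locScale d s := Nat.one_le_pow _ _ hs1
  have hexp1 : Real.exp (-Cc * Real.log ↑(2 * locScale d s) ^ 2) ≤ 1 := Real.exp_le_one_iff.2 (by
    have : 0 ≤ Real.log ↑(2 * locScale d s) ^ 2 := sq_nonneg _
    nlinarith)
  have hμ00 : 0 < c' * Real.exp (-Cc * Real.log ↑(2 * locScale d s) ^ 2) := mul_pos hc'0 (Real.exp_pos _)
  have hμ01 : c' * Real.exp (-Cc * Real.log ↑(2 * locScale d s) ^ 2) ≤ 1 := by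
    calc _ ≤ c' * 1 := mul_le_mul_of_nonneg_left hexp1 hc'0.le
      _ ≤ 1 := by linarith
  have hρ0 : 0 ≤ C43 * Real.exp (-(c43 * Real.log s ^ 4)) := by positivity
  have hmainS := real_badScaleEvent_le_main hd1 p hs1 h4S hμ00 hμ01 hρ0 hcor hρ hcond M
  refine hmainS.trans ?_
  -- `log(2S) ≤ 2ℓ`
  have hlog2S : Real.log ↑(2 * locScale d s) ≤ 2 * ℓ := by
    have h2S : ((2 * locScale d s : ℕ) : ℝ) = 2 * (s : ℝ) ^ (4 * d ^ 2) := by push_cast; rw [cast_locScale]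
    rw [h2S, Real.log_mul two_ne_zero (by positivity), Real.log_pow]
    have hlog2 : Real.log 2 ≤ 1 := by
      have := Real.add_one_le_exp (1 : ℝ)
      rw [Real.log_le_iff_le_exp two_pos]; linarith
    have h1 : ((4 * d ^ 2 : ℕ) : ℝ) * Real.log s ≤ (4 * (d : ℝ) ^ 2 * κ) * ℓ := by
      push_cast
      calc 4 * (d : ℝ) ^ 2 * Real.log s ≤ 4 * (d : ℝ) ^ 2 * (κ * ℓ) := mul_le_mul_of_nonneg_left hlogs (by positivity)
        _ = (4 * (d : ℝ) ^ 2 * κ) * ℓ := by ring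
    have h2 : (4 * (d : ℝ) ^ 2 * κ) * ℓ ≤ 1 * ℓ := mul_le_mul_of_nonneg_right h4dk1 hℓ0
    linarith
  have hlog2S0 : 0 ≤ Real.log ↑(2 * locScale d s) := Real.log_natCast_nonneg _
  -- `8/μ₀ ≤ (8/c') e^{4 Cc ℓ²}`... via `1/μ₀ = e^{Cc log²(2S)}/c'`
  have hμinv : 8 / (c' * Real.exp (-Cc * Real.log ↑(2 * locScale d s) ^ 2)) ≤ 8 / c' * Real.exp (4 * Cc * ℓ ^ 2) := by
    have hsq : Real.log ↑(2 * locScale d s) ^ 2 ≤ (2 * ℓ) ^ 2 := pow_le_pow_left₀ hlog2S0 hlog2S 2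
    have hE : Real.exp (Cc * Real.log ↑(2 * locScale d s) ^ 2) ≤ Real.exp (4 * Cc * ℓ ^ 2) :=
      Real.exp_le_exp.2 (by nlinarith)
    rw [show -Cc * Real.log ↑(2 * locScale d s) ^ 2 = -(Cc * Real.log ↑(2 * locScale d s) ^ 2) by ring, Real.exp_neg]
    rw [show 8 / (c' * (Real.exp (Cc * Real.log ↑(2 * locScale d s) ^ 2))⁻¹) =
      8 / c' * Real.exp (Cc * Real.log ↑(2 * locScale d s) ^ 2) by field_simp]
    exact mul_le_mul_of_nonneg_left hE (by positivity)
  -- `β ≤ 10^d e^{ℓ/2}`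
  have hβ : 2 ^ d * (s : ℝ) ^ 2 * (4 * locScale d s + 1 : ℝ) ^ d ≤ 10 ^ d * Real.exp (ℓ / 2) := by
    have hSr : ((locScale d s : ℕ) : ℝ) = (s : ℝ) ^ (4 * d ^ 2) := cast_locScale d s
    have hS1r : (1 : ℝ) ≤ (locScale d s : ℝ) := by exact_mod_cast hS1
    have h5 : (4 * locScale d s + 1 : ℝ) ≤ 5 * locScale d s := by linarith
    have h1 : (4 * locScale d s + 1 : ℝ) ^ d ≤ (5 * locScale d s : ℝ) ^ d := pow_le_pow_left₀ (by positivity) h5 d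
    have h2 : (s : ℝ) ^ 2 * ((locScale d s : ℝ)) ^ d = Real.exp (C₂ * Real.log s) := by
      rw [hSr, ← pow_mul, ← pow_add, ← Real.exp_log (pow_pos hs0 _), Real.log_pow, hC₂]
      push_cast; ring_nf
    have h3 : C₂ * Real.log s ≤ ℓ / 2 := by
      have hC₂0 : 0 ≤ C₂ := by rw [hC₂]; positivity
      calc C₂ * Real.log s ≤ C₂ * (κ * ℓ) := mul_le_mul_of_nonneg_left hlogs hC₂0
        _ = (C₂ * κ) * ℓ := by ring
        _ ≤ (1 / 2) * ℓ := mul_le_mul_of_nonneg_right hC₂κ' hℓ0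
        _ = ℓ / 2 := by ring
    calc 2 ^ d * (s : ℝ) ^ 2 * (4 * locScale d s + 1 : ℝ) ^ d ≤ 2 ^ d * (s : ℝ) ^ 2 * (5 * locScale d s : ℝ) ^ d := by
          gcongr
      _ = (2 ^ d * 5 ^ d) * ((s : ℝ) ^ 2 * (locScale d s : ℝ) ^ d) := by rw [mul_pow]; ring
      _ = 10 ^ d * Real.exp (C₂ * Real.log s) := by rw [h2, ← mul_pow]; norm_num
      _ ≤ 10 ^ d * Real.exp (ℓ / 2) := mul_le_mul_of_nonneg_left (Real.exp_le_exp.2 h3) (by positivity)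
  have hexpβ : Real.exp (-(M / (2 * (2 ^ d * (s : ℝ) ^ 2 * (4 * locScale d s + 1 : ℝ) ^ d)))) ≤
      Real.exp (-(Real.exp ℓ / (2 * 10 ^ d * Real.exp (ℓ / 2)))) := by
    refine Real.exp_le_exp.2 (neg_le_neg ?_)
    rw [← hMexp, show 2 * 10 ^ d * Real.exp (ℓ / 2) = 2 * (10 ^ d * Real.exp (ℓ / 2)) by ring]
    exact div_le_div_of_nonneg_left hM0.le (by positivity) (by nlinarith)
  have hG : (2 * (j + 2 * locScale d s) + 1 : ℝ) ^ d + 1 ≤ (4 * (j : ℝ)) ^ d + 1 := by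
    have h4 : (2 * (j + 2 * locScale d s) + 1 : ℝ) ≤ 4 * j := by
      have h' : ((4 * locScale d s + 1 : ℕ) : ℝ) ≤ j := by exact_mod_cast h4S
      have hj1 : (1 : ℝ) ≤ j := by exact_mod_cast hj
      push_cast at h'
      linarith
    have := pow_le_pow_left₀ (by positivity) h4 d
    linarith
  rw [hMexp] at hexpβ
  rw [hMexp]
  refine mul_le_mul_of_nonneg_left (add_le_add ?_ ?_) (by positivity)
  · exact mul_le_mul_of_nonneg_right hμinv (Real.exp_pos _).le
  · exact mul_le_mul hG hexpβ (Real.exp_pos _).le (by positivity)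

/-- **The crude bound for one scale** `s > s₀` in the form summed in (4.8): with
`log(s₀+1) ≥ κℓ`, `P(F_s) ≤ A' j^{d-1} C₄₃ e^{-(c₄₃/2) κ⁴ ℓ⁴} · e^{-(c₄₃/2) log⁴ s}`.
[cite: KozmaNachmias2011, proof of Theorem 5, (4.8) (p. 397)] -/
theorem thm5_scale_crude (p : unitInterval) {j s s₀ M : ℕ} (hj : 1 ≤ j) (hM1 : 1 ≤ M) (hss : s₀ < s)
    {C43 c43 κ ℓ : ℝ} (hC43 : 0 < C43) (hκℓ0 : 0 ≤ κ * ℓ) (hs₀' : Real.exp (κ * ℓ) < s₀ + 1)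
    (hρ : ∀ x : Site d, (bondPercolation (zdGraph d) p).real {ω | IsSLocBad p j s x ω} ≤ C43 * Real.exp (-(c43 * Real.log s ^ 4)))
    (hc43 : 0 < c43) :
    (bondPercolation (zdGraph d) p).real (badScaleEvent d p j s M) ≤
      (2 * d * 3 ^ (d - 1) * (j : ℝ) ^ (d - 1) * C43 * Real.exp (-(c43 / 2 * κ ^ 4 * ℓ ^ 4))) *
        Real.exp (-(c43 / 2 * Real.log s ^ 4)) := by
  have hs0 : (0 : ℝ) < s := by exact_mod_cast (show 0 < s by omega)
  refine (real_badScaleEvent_le_crude p j s hρ hM1).trans ?_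
  have hlogs₀ : κ * ℓ ≤ Real.log s := by
    rw [Real.le_log_iff_exp_le hs0]
    exact hs₀'.le.trans (by exact_mod_cast hss)
  have hlog4 : (κ * ℓ) ^ 4 ≤ Real.log s ^ 4 := pow_le_pow_left₀ hκℓ0 hlogs₀ 4
  have hsplit : C43 * Real.exp (-(c43 * Real.log s ^ 4)) ≤
      C43 * Real.exp (-(c43 / 2 * κ ^ 4 * ℓ ^ 4)) * Real.exp (-(c43 / 2 * Real.log s ^ 4)) := by
    rw [mul_assoc, ← Real.exp_add]
    refine mul_le_mul_of_nonneg_left (Real.exp_le_exp.2 ?_) hC43.le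
    have : κ ^ 4 * ℓ ^ 4 = (κ * ℓ) ^ 4 := by ring
    nlinarith
  calc (#(sphere d j) : ℝ) * (C43 * Real.exp (-(c43 * Real.log s ^ 4)))
      ≤ (2 * d * 3 ^ (d - 1) * (j : ℝ) ^ (d - 1)) *
          (C43 * Real.exp (-(c43 / 2 * κ ^ 4 * ℓ ^ 4)) * Real.exp (-(c43 / 2 * Real.log s ^ 4))) :=
        mul_le_mul (card_sphere_le_pow hj) hsplit (by positivity) (by positivity)
    _ = _ := by ring

/-- **The partial sums of the majorant** over the scales: finitely many main-regime terms and the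
crude tail, `Σ_{s<n} b_s ≤ s₀ · mainU + T · (⌈e^{max(1,4/c)}⌉ + 2)`. [folklore] -/
theorem thm5_partial_sum {K s₀ : ℕ} {mainU T c : ℝ} (hK : 1 ≤ K) (hmainU : 0 ≤ mainU) (hT : 0 ≤ T) (hc : 0 < c)
    (n : ℕ) :
    ∑ s ∈ Finset.range n,
        (if s < K then (0 : ℝ) else if s ≤ s₀ then mainU else T * Real.exp (-(c / 2 * Real.log s ^ 4))) ≤
      s₀ * mainU + T * (⌈Real.exp (max 1 (4 / c))⌉₊ + 2 : ℕ) := by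
  have hterm : ∀ s ∈ Finset.range n,
      (if s < K then (0 : ℝ) else if s ≤ s₀ then mainU else T * Real.exp (-(c / 2 * Real.log s ^ 4))) ≤
        (if K ≤ s ∧ s ≤ s₀ then mainU else 0) + T * Real.exp (-(c / 2 * Real.log s ^ 4)) := by
    intro s _
    have hT' : 0 ≤ T * Real.exp (-(c / 2 * Real.log s ^ 4)) := by positivity
    by_cases hKs : s < K
    · rw [if_pos hKs, if_neg (fun h => (not_le.2 hKs) h.1)]; linarith
    · rw [if_neg hKs]
      by_cases hss₀ : s ≤ s₀
      · rw [if_pos hss₀, if_pos ⟨not_lt.1 hKs, hss₀⟩]; linarith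
      · rw [if_neg hss₀, if_neg (fun h => hss₀ h.2)]; linarith
  calc _ ≤ ∑ s ∈ Finset.range n, ((if K ≤ s ∧ s ≤ s₀ then mainU else 0) + T * Real.exp (-(c / 2 * Real.log s ^ 4))) :=
        Finset.sum_le_sum hterm
    _ = ∑ s ∈ Finset.range n, (if K ≤ s ∧ s ≤ s₀ then mainU else 0) +
          T * ∑ s ∈ Finset.range n, Real.exp (-(c / 2 * Real.log s ^ 4)) := by
        rw [Finset.sum_add_distrib, Finset.mul_sum]
    _ ≤ s₀ * mainU + T * (⌈Real.exp (max 1 (4 / c))⌉₊ + 2 : ℕ) := by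
        refine add_le_add ?_ (mul_le_mul_of_nonneg_left ?_ hT)
        · rw [← Finset.sum_filter]
          calc ∑ s ∈ (Finset.range n).filter (fun s => K ≤ s ∧ s ≤ s₀), mainU
              = #((Finset.range n).filter (fun s => K ≤ s ∧ s ≤ s₀)) * mainU := by rw [Finset.sum_const, nsmul_eq_mul]
            _ ≤ s₀ * mainU := by
                refine mul_le_mul_of_nonneg_right ?_ hmainU
                have h1 : #((Finset.range n).filter (fun s => K ≤ s ∧ s ≤ s₀)) ≤ #(Finset.Icc K s₀) :=
                  Finset.card_le_card fun s hs => Finset.mem_Icc.2 (Finset.mem_filter.1 hs).2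
                have h2 : #(Finset.Icc K s₀) ≤ s₀ := by rw [Nat.card_Icc]; omega
                exact_mod_cast h1.trans h2
        · have h := sum_exp_neg_log_pow_four_le (a := c / 2) (by positivity) n
          have h4 : 2 / (c / 2) = 4 / c := by field_simp; ring
          rw [h4] at h
          refine le_trans (le_of_eq (Finset.sum_congr rfl fun s _ => ?_)) (h.trans (le_of_eq (by push_cast; ring)))
          ring_nf

/-- The exponent `κ = 1/(16 d³ (2 + 4d³))` of the scale cut-off `s₀ = M^κ`: elementary
inequalities. [folklore] -/
theorem thm5_kappa {d : ℕ} (hd7 : 7 ≤ d) {C₂ κ : ℝ} (hC₂ : C₂ = 2 + 4 * (d : ℝ) ^ 3) (hκ : κ = 1 / (16 * (d : ℝ) ^ 3 * C₂)) :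
    0 < κ ∧ κ ≤ 1 ∧ C₂ * κ ≤ 1 / 2 ∧ 4 * (d : ℝ) ^ 2 * κ ≤ 1 / (2 * ((d : ℝ) - 1)) ∧ 4 * (d : ℝ) ^ 2 * κ ≤ 1 := by
  have hd7r : (7 : ℝ) ≤ d := by exact_mod_cast hd7
  have hd1r : (1 : ℝ) ≤ d := by linarith
  have hd3 : (1 : ℝ) ≤ (d : ℝ) ^ 3 := one_le_pow₀ hd1r
  have hC₂1 : 1 ≤ C₂ := by rw [hC₂]; linarith
  have hC₂0 : 0 < C₂ := by linarith
  have h16 : (1 : ℝ) ≤ 16 * (d : ℝ) ^ 3 * C₂ := by nlinarith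
  have hκ0 : 0 < κ := by rw [hκ]; positivity
  have hκ1 : κ ≤ 1 := by rw [hκ]; exact (div_le_one (by positivity)).2 h16
  have hC₂κ : C₂ * κ = 1 / (16 * (d : ℝ) ^ 3) := by rw [hκ]; field_simp
  have hC₂κ' : C₂ * κ ≤ 1 / 2 := by
    rw [hC₂κ, div_le_div_iff₀ (by positivity) two_pos]; linarith
  have h4dk : 4 * (d : ℝ) ^ 2 * κ ≤ 1 / (2 * ((d : ℝ) - 1)) := by
    rw [hκ, show 4 * (d : ℝ) ^ 2 * (1 / (16 * (d : ℝ) ^ 3 * C₂)) = 4 * (d : ℝ) ^ 2 / (16 * (d : ℝ) ^ 3 * C₂) by ring,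
      div_le_div_iff₀ (by positivity) (by linarith)]
    have h1 : (d : ℝ) ^ 2 * ((d : ℝ) - 1) ≤ (d : ℝ) ^ 3 := by nlinarith [sq_nonneg (d : ℝ)]
    have h2 : (d : ℝ) ^ 3 ≤ (d : ℝ) ^ 3 * C₂ := le_mul_of_one_le_right (by positivity) hC₂1
    nlinarith
  have h4dk1 : 4 * (d : ℝ) ^ 2 * κ ≤ 1 := by
    refine h4dk.trans ?_
    rw [div_le_one (by linarith)]; linarith
  exact ⟨hκ0, hκ1, hC₂κ', h4dk, h4dk1⟩

/-- `4S < j` for the scales `s ≤ s₀` of the main regime (`log s ≤ κ log M`, `M ≤ A' j^{d-1}`,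
`log M` large). [cite: KozmaNachmias2011, proof of Theorem 5 ("if s is sufficiently small such that s^{4d²} < j")] -/
theorem thm5_four_S_lt {d : ℕ} (hd1 : 1 ≤ d) (hdm1 : (0 : ℝ) < (d : ℝ) - 1) {j s M : ℕ} (hj : 1 ≤ j) (hs1 : 1 ≤ s)
    {A' κ ℓ : ℝ} (hA'0 : 0 < A') (hℓ0 : 0 ≤ ℓ) (hMexp : (M : ℝ) = Real.exp ℓ)
    (hMA : (M : ℝ) ≤ A' * (j : ℝ) ^ (d - 1)) (hℓ4 : 2 * ((d : ℝ) - 1) * Real.log 4 + 2 * Real.log A' + 1 ≤ ℓ)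
    (h4dk : 4 * (d : ℝ) ^ 2 * κ ≤ 1 / (2 * ((d : ℝ) - 1))) (hlogs : Real.log s ≤ κ * ℓ) :
    4 * locScale d s < j := by
  have hj0 : (0 : ℝ) < j := by exact_mod_cast (show 0 < j by omega)
  have hs0 : (0 : ℝ) < s := by exact_mod_cast hs1
  have hM0r : (0 : ℝ) < M := by rw [hMexp]; exact Real.exp_pos ℓ
  have hlogj : (ℓ - Real.log A') / ((d : ℝ) - 1) ≤ Real.log j := by
    rw [div_le_iff₀ hdm1]
    have h1 : ℓ ≤ Real.log (A' * (j : ℝ) ^ (d - 1)) := by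
      rw [← Real.log_exp ℓ, ← hMexp]; exact Real.log_le_log hM0r hMA
    rw [Real.log_mul hA'0.ne' (by positivity), Real.log_pow] at h1
    have h2 : ((d - 1 : ℕ) : ℝ) = (d : ℝ) - 1 := by rw [Nat.cast_sub hd1, Nat.cast_one]
    rw [h2] at h1
    linarith
  have hlogj4 : Real.log 4 + 4 * (d : ℝ) ^ 2 * κ * ℓ < Real.log j := by
    have h1 : 4 * (d : ℝ) ^ 2 * κ * ℓ ≤ ℓ / (2 * ((d : ℝ) - 1)) := by
      calc 4 * (d : ℝ) ^ 2 * κ * ℓ ≤ (1 / (2 * ((d : ℝ) - 1))) * ℓ := mul_le_mul_of_nonneg_right h4dk hℓ0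
        _ = ℓ / (2 * ((d : ℝ) - 1)) := by ring
    have h2 : Real.log 4 + ℓ / (2 * ((d : ℝ) - 1)) < (ℓ - Real.log A') / ((d : ℝ) - 1) := by
      rw [lt_div_iff₀ hdm1]
      have he : (Real.log 4 + ℓ / (2 * ((d : ℝ) - 1))) * ((d : ℝ) - 1) = ((d : ℝ) - 1) * Real.log 4 + ℓ / 2 := by
        field_simp
      rw [he]
      linarith
    linarith
  have hS : ((locScale d s : ℕ) : ℝ) ≤ Real.exp (4 * (d : ℝ) ^ 2 * κ * ℓ) := by
    rw [cast_locScale, ← Real.exp_log (pow_pos hs0 _), Real.log_pow]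
    refine Real.exp_le_exp.2 ?_
    push_cast
    calc (4 * (d : ℝ) ^ 2) * Real.log s ≤ (4 * (d : ℝ) ^ 2) * (κ * ℓ) :=
          mul_le_mul_of_nonneg_left hlogs (by positivity)
      _ = 4 * (d : ℝ) ^ 2 * κ * ℓ := by ring
  have h2 : (4 : ℝ) * Real.exp (4 * (d : ℝ) ^ 2 * κ * ℓ) < j := by
    have : Real.exp (Real.log 4 + 4 * (d : ℝ) ^ 2 * κ * ℓ) < Real.exp (Real.log j) := Real.exp_lt_exp.2 hlogj4
    rwa [Real.exp_add, Real.exp_log (by norm_num : (0:ℝ) < 4), Real.exp_log hj0] at this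
  have h3 : ((4 * locScale d s : ℕ) : ℝ) < j := by push_cast; linarith [hS, h2]
  exact_mod_cast h3

/-- **Theorem 5 in the main regime** (`K ≥ 3` beyond the threshold of `thm5_cond`, `j ≥ 1`,
`ℓ = log M` large, `M ≤ A' j^{d-1}`): the probability of `{M ≤ X_j ≤ 2 X_j^{K-loc-irr}}` is at
most `C_main j^d e^{-c ℓ²}` — the union over the scales with the main estimate (4.7) for
`s ≤ s₀ = ⌊M^κ⌋` and the crude one (4.8) beyond. [cite: KozmaNachmias2011, Thm. 5 and its proof (pp. 396–398)] -/
theorem thm5_main_regime (hd1 : 1 ≤ d) (hd7 : 7 ≤ d) (p : unitInterval) {K j M : ℕ} (hK3 : 3 ≤ K) (hj : 1 ≤ j)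
    {c' Cc C43 c43 κ C₂ cfin ℓ L₁ : ℝ} (hc'0 : 0 < c') (hc'1 : c' ≤ 1) (hCc : 0 < Cc) (hC43 : 0 < C43) (hc43 : 0 < c43)
    (hC₂ : C₂ = 2 + 4 * (d : ℝ) ^ 3) (hκ : κ = 1 / (16 * (d : ℝ) ^ 3 * C₂))
    (hcfin1 : cfin ≤ 1) (hcfinκ : cfin ≤ c43 / 2 * κ ^ 4)
    (hL₁ : L₁ = max 1 ((3 * max (Real.log (16 * 50 ^ d * C43 / c')) 0 + 3 * (2 + 8 * (d : ℝ) ^ 3) +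
      75 * Cc * (d : ℝ) ^ 4) / c43)) (hKL : Real.exp L₁ ≤ K)
    (hℓ1 : 1 ≤ ℓ) (hℓa : 24 * (4 * Cc + 2) ≤ ℓ) (hℓb : 184320 * 10 ^ d ≤ ℓ)
    (hℓ4 : 2 * ((d : ℝ) - 1) * Real.log 4 + 2 * Real.log (2 * d * 3 ^ (d - 1)) + 1 ≤ ℓ)
    (hMexp : (M : ℝ) = Real.exp ℓ) (hMA : (M : ℝ) ≤ 2 * d * 3 ^ (d - 1) * (j : ℝ) ^ (d - 1))
    (hcor : ∀ s' : ℕ, 1 ≤ s' → ∀ (x : Site d), (∃ w' ∈ sphere d j, w' - x ∈ box d s') → ∀ y ∈ box d j,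
      y - x ∈ box d s' → c' * Real.exp (-Cc * Real.log ↑s' ^ 2) ≤
        (bondPercolation (zdGraph d) p).real {ω | ∃ w' ∈ sphere d j, ω ∈ openConnIn
          (↑((box d j).filter fun u => u - x ∈ box d s') : Set (Site d)) y w'})
    (hρ : ∀ (s : ℕ) (x : Site d), (bondPercolation (zdGraph d) p).real {ω | IsSLocBad p j s x ω} ≤
      C43 * Real.exp (-(c43 * Real.log s ^ 4))) :
    (bondPercolation (zdGraph d) p).real {ω | M ≤ boundaryConnCount d j ω ∧
        boundaryConnCount d j ω ≤ 2 * locIrrBoundaryConnCount d p j K ω} ≤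
      (2 ^ d * (8 / c' + 4 ^ d + 1) + 2 * d * 3 ^ (d - 1) * C43 * (⌈Real.exp (max 1 (4 / c43))⌉₊ + 2 : ℕ)) *
        (j : ℝ) ^ d * Real.exp (-(cfin * ℓ ^ 2)) := by
  set μ := bondPercolation (zdGraph d) p with hμ
  obtain ⟨hκ0, hκ1, hC₂κ', h4dk, h4dk1⟩ := thm5_kappa hd7 hC₂ hκ
  have hdm1 : (0 : ℝ) < (d : ℝ) - 1 := by
    have : (7 : ℝ) ≤ d := by exact_mod_cast hd7
    linarith
  have hℓ0 : 0 ≤ ℓ := by linarith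
  have hA'0 : (0 : ℝ) < 2 * d * 3 ^ (d - 1) := by
    have : (0 : ℝ) < d := by exact_mod_cast (show 0 < d by omega)
    positivity
  have hM0r : (0 : ℝ) < M := by rw [hMexp]; exact Real.exp_pos ℓ
  have hM1 : 1 ≤ M := by
    have : (1 : ℝ) ≤ M := by rw [hMexp]; exact Real.one_le_exp hℓ0
    exact_mod_cast this
  -- the scale cut-off `s₀ = ⌊M^κ⌋`
  obtain ⟨s₀, hs₀def⟩ : ∃ s₀ : ℕ, s₀ = ⌊Real.exp (κ * ℓ)⌋₊ := ⟨_, rfl⟩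
  have hs₀ : (s₀ : ℝ) ≤ Real.exp (κ * ℓ) := by rw [hs₀def]; exact Nat.floor_le (Real.exp_pos _).le
  have hs₀' : Real.exp (κ * ℓ) < s₀ + 1 := by rw [hs₀def]; exact Nat.lt_floor_add_one _
  have hlogs : ∀ s : ℕ, 1 ≤ s → s ≤ s₀ → Real.log s ≤ κ * ℓ := by
    intro s hs1 hss₀
    have hs0 : (0 : ℝ) < s := by exact_mod_cast hs1
    rw [Real.log_le_iff_le_exp hs0]
    exact le_trans (by exact_mod_cast hss₀) hs₀
  -- the uniform main bound for `K ≤ s ≤ s₀`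
  obtain ⟨mainU, hmainU⟩ : ∃ mainU : ℝ, mainU = 2 ^ d * (8 / c' * Real.exp (4 * Cc * ℓ ^ 2) * Real.exp (-Real.exp ℓ) +
    ((4 * (j : ℝ)) ^ d + 1) * Real.exp (-(Real.exp ℓ / (2 * 10 ^ d * Real.exp (ℓ / 2))))) := ⟨_, rfl⟩
  have hmainU0 : 0 ≤ mainU := by rw [hmainU]; positivity
  have hmain : ∀ s : ℕ, K ≤ s → s ≤ s₀ → μ.real (badScaleEvent d p j s M) ≤ mainU := by
    intro s hKs hss₀
    have hs1 : 1 ≤ s := by omega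
    have hs2 : 2 ≤ s := by omega
    have hs0 : (0 : ℝ) < s := by exact_mod_cast hs1
    have hLs : max 1 ((3 * max (Real.log (16 * 50 ^ d * C43 / c')) 0 + 3 * (2 + 8 * (d : ℝ) ^ 3) +
        75 * Cc * (d : ℝ) ^ 4) / c43) ≤ Real.log s := by
      rw [← hL₁, Real.le_log_iff_exp_le hs0]
      exact hKL.trans (by exact_mod_cast hKs)
    have hcond := thm5_cond hd1 hc43 hC43 hc'0 hCc hs2 hLs
    have hS1 : 1 ≤ 2 * locScale d s := by have := Nat.one_le_pow (4 * d ^ 2) s hs1; rw [locScale]; omega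
    rw [hmainU]
    exact thm5_scale_main hd1 p hj hs1 hc'0 hc'1 hCc hC43 hC₂ hC₂κ' h4dk1 hℓ1 hMexp (hlogs s hs1 hss₀)
      (thm5_four_S_lt hd1 hdm1 hj hs1 hA'0 hℓ0 hMexp hMA hℓ4 h4dk (hlogs s hs1 hss₀))
      (hcor (2 * locScale d s) hS1) (hρ s) hcond
  -- the crude tail
  obtain ⟨T1c, hT1c⟩ : ∃ T1c : ℝ, T1c = 2 * d * 3 ^ (d - 1) * (j : ℝ) ^ (d - 1) * C43 *
    Real.exp (-(c43 / 2 * κ ^ 4 * ℓ ^ 4)) := ⟨_, rfl⟩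
  have hT1c0 : 0 ≤ T1c := by rw [hT1c]; positivity
  have hcrude : ∀ s : ℕ, s₀ < s → μ.real (badScaleEvent d p j s M) ≤ T1c * Real.exp (-(c43 / 2 * Real.log s ^ 4)) := by
    intro s hss
    rw [hT1c]
    exact thm5_scale_crude p hj hM1 hss hC43 (by positivity) hs₀' (hρ s) hc43
  -- the majorant
  set b : ℕ → ℝ := fun s => if s < K then 0 else if s ≤ s₀ then mainU else T1c * Real.exp (-(c43 / 2 * Real.log s ^ 4))
    with hb
  have hb0 : ∀ s, 0 ≤ b s := by
    intro s; simp only [hb]; split_ifs <;> positivity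
  set F : ℕ → Set (BondConfig (Site d)) := fun s => if K ≤ s then badScaleEvent d p j s M else ∅ with hF
  have hFb : ∀ s, μ.real (F s) ≤ b s := by
    intro s
    by_cases hKs : K ≤ s
    · simp only [hF, hb, if_pos hKs, if_neg (not_lt.2 hKs)]
      by_cases hss₀ : s ≤ s₀
      · rw [if_pos hss₀]; exact hmain s hKs hss₀
      · rw [if_neg hss₀]; exact hcrude s (not_le.1 hss₀)
    · simp only [hF, hb, if_neg hKs, if_pos (not_le.1 hKs), measureReal_empty, le_refl]
  have hpartial : ∀ n, ∑ s ∈ Finset.range n, b s ≤ s₀ * mainU + T1c * (⌈Real.exp (max 1 (4 / c43))⌉₊ + 2 : ℕ) :=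
    fun n => thm5_partial_sum (K := K) (s₀ := s₀) (by omega) hmainU0 hT1c0 hc43 n
  have hfinal := measureReal_le_of_subset_iUnion (μ := μ) (thm5Event_subset_iUnion (d := d) (j := j) (M := M) p hK3)
    hb0 hFb hpartial
  refine hfinal.trans ?_
  rw [hmainU, hT1c]
  exact thm5_arith (d := d) hc43 hC43 hc'0 hCc hA'0 hκ0 hκ1 hcfin1 hcfinκ hj hℓ1 hℓa hℓb hs₀

/-- **Theorem 4 of Kozma–Nachmias 2011 from (1.1)** — the regularity theorem
`P(X_j ≥ M and X_j^{K-irr} ≥ X_j/2) ≤ C j^d exp(-c log² M)` (`K ≥ K₀`, `j ≥ 1`, all `M`), i.e.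
the named fact `KozmaNachmias2011_thm4` of `KozmaNachmiasRegularity.lean`, deduced, exactly as in
the source, from Claim 4.2 (`irrBoundaryConnCount_le_locIrr`) and Theorem 5, the latter proved here
from Lemma 4.3 (`KozmaNachmias2011_lemma43`, whose inputs are the volume estimate (1.1),
`KozmaNachmias2011_volumeTail`, and the large deviations of Lemma 4.4, proved as
`volumeLD_of_twoPointBoundedRatio`), Corollary 3.2 and the exploration estimates Lemmas 4.5–4.6
(`real_badScaleEvent_le_main`), with the union over the scales `s ≥ K` split at `s₀ = ⌊M^κ⌋`
((4.7) for `s ≤ s₀`, (4.8) for `s > s₀`).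
[cite: KozmaNachmias2011, Thm. 4 and Thm. 5 with their proofs (§4.2, p. 392; §4.4, pp. 396–398)] -/
theorem KozmaNachmias2011_thm4_of (h11 : KozmaNachmias2011_volumeTail) : KozmaNachmias2011_thm4 := by
  intro d hd hτ
  classical
  have hd1 : 1 ≤ d := by omega
  have hd2 : 2 ≤ d := by omega
  have hd7 : 7 ≤ d := by omega
  set p := criticalProbI d with hp
  set μ := bondPercolation (zdGraph d) p with hμ
  have hp0 : 0 < (p : ℝ) := by rw [hp, coe_criticalProbI]; exact criticalProb_zd_pos d hd1
  have hp1 : (p : ℝ) < 1 := by rw [hp, coe_criticalProbI]; exact criticalProb_zd_lt_one hd2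
  -- Lemma 4.3 and Corollary 3.2
  obtain ⟨C43, c43, hc43, hC43, h43⟩ :=
    KozmaNachmias2011_lemma43 hd hτ h11 (volumeLD_of_twoPointBoundedRatio hd hτ)
  obtain ⟨cc, Cc, hcc, hCc, hcor⟩ := KozmaNachmias2011_cor32 (d := d) p hd2 (by rw [hp, coe_criticalProbI])
  obtain ⟨c', hc'⟩ : ∃ c' : ℝ, c' = min cc 1 := ⟨_, rfl⟩
  have hc'0 : 0 < c' := by rw [hc']; exact lt_min hcc zero_lt_one
  have hc'1 : c' ≤ 1 := by rw [hc']; exact min_le_right _ _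
  have hc'c : c' ≤ cc := by rw [hc']; exact min_le_left _ _
  -- constants
  obtain ⟨C₂, hC₂⟩ : ∃ C₂ : ℝ, C₂ = 2 + 4 * (d : ℝ) ^ 3 := ⟨_, rfl⟩
  obtain ⟨κ, hκ⟩ : ∃ κ : ℝ, κ = 1 / (16 * (d : ℝ) ^ 3 * C₂) := ⟨_, rfl⟩
  obtain ⟨hκ0, hκ1, -, -, -⟩ := thm5_kappa hd7 hC₂ hκ
  obtain ⟨cfin, hcfin⟩ : ∃ cfin : ℝ, cfin = min 1 (c43 / 2 * κ ^ 4) := ⟨_, rfl⟩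
  have hcfin0 : 0 < cfin := by rw [hcfin]; exact lt_min zero_lt_one (by positivity)
  have hcfin1 : cfin ≤ 1 := by rw [hcfin]; exact min_le_left _ _
  have hcfinκ : cfin ≤ c43 / 2 * κ ^ 4 := by rw [hcfin]; exact min_le_right _ _
  obtain ⟨Cmain, hCmain⟩ : ∃ Cmain : ℝ, Cmain = 2 ^ d * (8 / c' + 4 ^ d + 1) +
    2 * d * 3 ^ (d - 1) * C43 * (⌈Real.exp (max 1 (4 / c43))⌉₊ + 2 : ℕ) := ⟨_, rfl⟩
  have hCmain0 : 0 ≤ Cmain := by rw [hCmain]; positivity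
  obtain ⟨L₁, hL₁⟩ : ∃ L₁ : ℝ, L₁ = max 1 ((3 * max (Real.log (16 * 50 ^ d * C43 / c')) 0 + 3 * (2 + 8 * (d : ℝ) ^ 3) +
    75 * Cc * (d : ℝ) ^ 4) / c43) := ⟨_, rfl⟩
  obtain ⟨ℓ₀, hℓ₀⟩ : ∃ ℓ₀ : ℝ, ℓ₀ = max (max 1 (24 * (4 * Cc + 2)))
    (max (184320 * 10 ^ d) (2 * ((d : ℝ) - 1) * Real.log 4 + 2 * Real.log (2 * d * 3 ^ (d - 1)) + 1)) := ⟨_, rfl⟩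
  have hℓ₀1 : 1 ≤ ℓ₀ := by rw [hℓ₀]; exact le_trans (le_max_left _ _) (le_max_left _ _)
  obtain ⟨Cbig, hCbig⟩ : ∃ Cbig : ℝ, Cbig = max Cmain 1 * Real.exp (cfin * ℓ₀ ^ 2) := ⟨_, rfl⟩
  have hCbig1 : 1 ≤ Cbig := by
    rw [hCbig]; exact one_le_mul_of_one_le_of_one_le (le_max_right _ _) (Real.one_le_exp (by positivity))
  have hCmainbig : Cmain ≤ Cbig + 1 := by
    rw [hCbig]
    calc Cmain ≤ max Cmain 1 := le_max_left _ _
      _ = max Cmain 1 * 1 := (mul_one _).symm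
      _ ≤ max Cmain 1 * Real.exp (cfin * ℓ₀ ^ 2) :=
          mul_le_mul_of_nonneg_left (Real.one_le_exp (by positivity)) (le_trans zero_le_one (le_max_right _ _))
      _ ≤ _ := by linarith
  refine ⟨Cbig + 1, cfin, hcfin0, by linarith, max 3 ⌈Real.exp L₁⌉₊, ?_⟩
  intro K hK j hj M
  have hK3 : 3 ≤ K := le_trans (le_max_left _ _) hK
  have hKL : Real.exp L₁ ≤ K := le_trans (Nat.le_ceil _) (by exact_mod_cast le_trans (le_max_right _ _) hK)
  have hj1r : (1 : ℝ) ≤ j := by exact_mod_cast hj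
  have hjd1 : (1 : ℝ) ≤ (j : ℝ) ^ d := one_le_pow₀ hj1r
  have hRHS1 : ∀ x : ℝ, x ^ 2 ≤ ℓ₀ ^ 2 → 1 ≤ (Cbig + 1) * (j : ℝ) ^ d * Real.exp (-(cfin * x ^ 2)) := by
    intro x hx
    have h1 : Real.exp (cfin * x ^ 2) ≤ Cbig := by
      rw [hCbig]
      calc Real.exp (cfin * x ^ 2) ≤ Real.exp (cfin * ℓ₀ ^ 2) := Real.exp_le_exp.2 (by nlinarith)
        _ = 1 * Real.exp (cfin * ℓ₀ ^ 2) := (one_mul _).symm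
        _ ≤ max Cmain 1 * Real.exp (cfin * ℓ₀ ^ 2) := mul_le_mul_of_nonneg_right (le_max_right _ _) (Real.exp_pos _).le
    have h2 : 1 ≤ Cbig * Real.exp (-(cfin * x ^ 2)) := by
      rw [Real.exp_neg, ← div_eq_mul_inv, le_div_iff₀ (Real.exp_pos _), one_mul]; exact h1
    calc (1 : ℝ) ≤ Cbig * Real.exp (-(cfin * x ^ 2)) := h2
      _ ≤ (Cbig + 1) * (j : ℝ) ^ d * Real.exp (-(cfin * x ^ 2)) := by
          refine mul_le_mul_of_nonneg_right ?_ (Real.exp_pos _).le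
          calc Cbig = Cbig * 1 := (mul_one _).symm
            _ ≤ (Cbig + 1) * (j : ℝ) ^ d := mul_le_mul (by linarith) hjd1 zero_le_one (by linarith)
  -- (a) small `M`
  by_cases hMbig : (M : ℝ) < Real.exp ℓ₀
  · refine le_trans measureReal_le_one (hRHS1 (Real.log M) ?_)
    have hlog0 : 0 ≤ Real.log (M : ℝ) := Real.log_natCast_nonneg M
    have hlogle : Real.log (M : ℝ) ≤ ℓ₀ := by
      rcases Nat.eq_zero_or_pos M with hM0 | hM0
      · rw [hM0, Nat.cast_zero, Real.log_zero]; linarith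
      · rw [Real.log_le_iff_le_exp (by exact_mod_cast hM0)]; exact hMbig.le
    exact pow_le_pow_left₀ hlog0 hlogle 2
  push Not at hMbig
  have hM0r : (0 : ℝ) < M := lt_of_lt_of_le (Real.exp_pos _) hMbig
  -- (b) `M` larger than `|∂Q_j|`: empty event
  by_cases hMsph : #(sphere d j) < M
  · have hempty : {ω : BondConfig (Site d) | M ≤ boundaryConnCount d j ω ∧
        boundaryConnCount d j ω ≤ 2 * irrBoundaryConnCount d (criticalProbI d) j K ω} = ∅ := by
      ext ω
      simp only [Set.mem_setOf_eq, Set.mem_empty_iff_false, iff_false, not_and]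
      intro hMX
      have := boundaryConnCount_le_card_sphere (d := d) j ω
      omega
    rw [hempty, measureReal_empty]
    positivity
  push Not at hMsph
  -- (c) the main regime
  obtain ⟨ℓ, hℓ⟩ : ∃ ℓ : ℝ, ℓ = Real.log M := ⟨_, rfl⟩
  have hℓℓ₀ : ℓ₀ ≤ ℓ := by rw [hℓ, Real.le_log_iff_exp_le hM0r]; exact hMbig
  have hℓ1 : 1 ≤ ℓ := hℓ₀1.trans hℓℓ₀
  have hMexp : (M : ℝ) = Real.exp ℓ := by rw [hℓ, Real.exp_log hM0r]
  have hℓa : 24 * (4 * Cc + 2) ≤ ℓ := by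
    refine le_trans ?_ hℓℓ₀; rw [hℓ₀]; exact le_trans (le_max_right _ _) (le_max_left _ _)
  have hℓb : 184320 * 10 ^ d ≤ ℓ := by
    refine le_trans ?_ hℓℓ₀; rw [hℓ₀]; exact le_trans (le_max_left _ _) (le_max_right _ _)
  have hℓ4 : 2 * ((d : ℝ) - 1) * Real.log 4 + 2 * Real.log (2 * d * 3 ^ (d - 1)) + 1 ≤ ℓ := by
    refine le_trans ?_ hℓℓ₀; rw [hℓ₀]; exact le_trans (le_max_right _ _) (le_max_right _ _)
  have hMA : (M : ℝ) ≤ 2 * d * 3 ^ (d - 1) * (j : ℝ) ^ (d - 1) :=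
    le_trans (by exact_mod_cast hMsph) (card_sphere_le_pow hj)
  have hcor' : ∀ s' : ℕ, 1 ≤ s' → ∀ (x : Site d), (∃ w' ∈ sphere d j, w' - x ∈ box d s') → ∀ y ∈ box d j,
      y - x ∈ box d s' → c' * Real.exp (-Cc * Real.log ↑s' ^ 2) ≤ μ.real
        {ω | ∃ w' ∈ sphere d j, ω ∈ openConnIn (↑((box d j).filter fun u => u - x ∈ box d s') : Set (Site d)) y w'} :=
    fun s' hs' x hx y hy hyx => le_trans (mul_le_mul_of_nonneg_right hc'c (Real.exp_pos _).le) (hcor j s' hs' x hx y hy hyx)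
  -- Claim 4.2: irregular vertices are locally irregular, almost surely
  have hEvloc : μ.real {ω | M ≤ boundaryConnCount d j ω ∧
      boundaryConnCount d j ω ≤ 2 * irrBoundaryConnCount d (criticalProbI d) j K ω} ≤
      μ.real {ω | M ≤ boundaryConnCount d j ω ∧ boundaryConnCount d j ω ≤ 2 * locIrrBoundaryConnCount d p j K ω} := by
    refine real_mono_of_forall_subset_edgeSet (zdGraph d) p fun ω hω hωE => ?_
    obtain ⟨hMX, hX⟩ := hωE
    exact ⟨hMX, hX.trans (Nat.mul_le_mul_left 2 (irrBoundaryConnCount_le_locIrr hd1 hp0 hp1 hK3 hω))⟩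
  have hmain := thm5_main_regime hd1 hd7 p hK3 hj hc'0 hc'1 hCc hC43 hc43 hC₂ hκ hcfin1 hcfinκ hL₁ hKL hℓ1 hℓa hℓb hℓ4
    hMexp hMA hcor' (fun s x => h43 j s x)
  rw [← hCmain] at hmain
  calc _ ≤ _ := hEvloc
    _ ≤ Cmain * (j : ℝ) ^ d * Real.exp (-(cfin * ℓ ^ 2)) := hmain
    _ ≤ (Cbig + 1) * (j : ℝ) ^ d * Real.exp (-(cfin * Real.log M ^ 2)) := by
        rw [← hℓ]
        exact mul_le_mul_of_nonneg_right (mul_le_mul_of_nonneg_right hCmainbig (by positivity)) (Real.exp_pos _).le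

/-- **Theorem 4 of Kozma–Nachmias 2011 (the regularity theorem) — DISCHARGE of the named fact
`KozmaNachmias2011_thm4`**: for `d > 6` under the two-point estimate (1.2), at `p = p_c`,
`P(X_j ≥ M and X_j^{K-irr} ≥ X_j/2) ≤ C j^d e^{-c log² M}` for `K ≥ K₀`, `j ≥ 1` and all `M`.
All inputs are theorems of the tree: (1.1) from Aizenman–Newman's `γ = 1`
(`KozmaNachmias2011_volumeTail_holds`), Lemma 4.4 from the tree-graph bounds
(`volumeLD_of_twoPointBoundedRatio`), Lemma 1.1/Corollary 3.2, Claims 4.1–4.2, Lemma 4.3 and the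
exploration Lemmas 4.5–4.6.
[cite: KozmaNachmias2011, Thm. 4 (§4.2, p. 392) and Thm. 5 (§4.4, pp. 396–398)] -/
theorem KozmaNachmias2011_thm4_holds : KozmaNachmias2011_thm4 :=
  KozmaNachmias2011_thm4_of KozmaNachmias2011_volumeTail_holds

end Final

end Literature.Barriers.CriticalPhenomena

end
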